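import Mathlib
import Literature.MathematicalPhysics.QuantumLattice.AngularSectors
import Literature.MathematicalPhysics.QuantumLattice.HubbardFermiCurve
import Literature.MathematicalPhysics.QuantumLattice.HubbardUmklappFold
import Literature.MathematicalPhysics.QuantumLattice.HubbardBandSectorCountingBounds
import HarnessLib

/-!
# Four-sector counting on the band Fermi curve of the square-lattice dispersion: the toolbox

Topic `Literature/MathematicalPhysics/QuantumLattice`; sub-namespace `BandSectorCounting`. The geometric and
combinatorial input of the single-scale isotropic four-sector counting lemma of Benfatto–Giuliani–Mastropietro
(Ann. Henri Poincaré 7 (2006), Lemma 3.1 / App. A2 (A2.0), `|A_h(ω₁;ω₂,ω₃,ω₄)| ≤ Cγ^{-h}|h|`) on the WHOLE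
hole-doped band `-4 < μ < 0` of `ε(k) = -2(cos k₁ + cos k₂)` and modulo `2πℤ²` (the count itself is
`HubbardBandSectorCountingCounts.lean`; the summit-side statement is the stub `stub_fourSectorCount` of
`Summits/HubbardSuperconductivity`):

* §1 one-dimensional grid counting by "chopping": a finite set of grid points in which any two admissible points
  within `ℓ` (and of the same colour) are within `L` has `≤ (Nw/ℓ + 1)·2(L/w + 1)` points; the four pairwise
  closeness lemmas (transversal with a derivative threshold, transversal, stratified second-order, fold-in-`t`)
  and the resulting counts `gridCount_L2 … gridCount_L5`; the harmonic and the dyadic summation lemmas;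
* §2 (definitions and uniform constants `BandBounds` are in `HubbardBandSectorCountingBounds.lean`) the calculus
  of the level function of three curve points `h(θ₂, θ₃) = ε(p(θ₁) + p(θ₂) + p(θ₃)) - μ` (`hfun`, partials
  `h3`, `h33`, the anti-diagonal combination `Gfun`), localisation of near-level points on the curve modulo `2πℤ²`,
  alignment modulo `π` through the Gauss map, and the four non-degeneracy lemmas: covering (`cover`), Cooper-line
  transversality (`odd_transversal`), the fold key bound (`even_key`) and the stratified diagonal (`diag_strat`);
* §3 cell geometry (`cell`: a shell momentum in a sector is within `D w` of the curve point at the sector centre),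
  few grid points in a small box (`card_grid_in_box_le`), and the reduction of the four-momentum condition to
  `|h| ≤ 4r` (`abs_hfun_le_of_sum`).

Everything is PROVED. [folklore] elementary real analysis on the explicit dispersion; the counting scheme follows
BGM 2006 App. A2 and BGM 2003 §7 (Lemmas 7.2–7.5).

## Sources

* G. Benfatto, A. Giuliani, V. Mastropietro, Ann. Henri Poincaré 7 (2006) 809–898, Lemma 3.1, App. A2.
  [BenfattoGiulianiMastropietro2006]
* G. Benfatto, A. Giuliani, V. Mastropietro, Ann. Henri Poincaré 4 (2003) 137–193, §7. [BenfattoGiulianiMastropietro2003]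
-/

noncomputable section

open Real Set
open Literature.MathematicalPhysics.QuantumLattice

namespace Literature.MathematicalPhysics.QuantumLattice.BandSectorCounting

/-! ### Finite sets of naturals with bounded diameter -/

/-- A finite set of naturals whose elements are pairwise within `D` (as reals) has at most
`D + 1` elements. [folklore] -/
theorem natCard_le_of_diam {S : Finset ℕ} {D : ℝ} (hD : 0 ≤ D)
    (h : ∀ i ∈ S, ∀ j ∈ S, (j : ℝ) - i ≤ D) : (S.card : ℝ) ≤ D + 1 := by
  rcases S.eq_empty_or_nonempty with rfl | hne
  · simp; linarith
  · set m := S.min' hne with hm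
    have hsub : S ⊆ Finset.Icc m (m + ⌊D⌋₊) := by
      intro j hj
      rw [Finset.mem_Icc]
      refine ⟨S.min'_le j hj, ?_⟩
      have h1 := h m (S.min'_mem hne) j hj
      have hmj : m ≤ j := S.min'_le j hj
      have h2 : ((j - m : ℕ) : ℝ) ≤ D := by push_cast [Nat.cast_sub hmj]; linarith
      have h3 : j - m ≤ ⌊D⌋₊ := (Nat.le_floor_iff hD).2 h2
      omega
    calc (S.card : ℝ) ≤ ((Finset.Icc m (m + ⌊D⌋₊)).card : ℝ) := by
          exact_mod_cast Finset.card_le_card hsub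
      _ = ⌊D⌋₊ + 1 := by
          rw [Nat.card_Icc]; push_cast [Nat.cast_sub (by omega : m ≤ m + ⌊D⌋₊ + 1)]; ring
      _ ≤ D + 1 := by linarith [Nat.floor_le hD]

/-- **Chopping**: if any two admissible grid points that are within `ℓ` of each other and carry
the same colour are in fact within `L`, then the number of admissible grid points among
`x₀ + i w`, `i < N`, is at most `(N w / ℓ + 1) · 2 (L / w + 1)`. [folklore] -/
theorem gridCard_le_chop {x₀ w ℓ L : ℝ} (hw : 0 < w) (hℓ : 0 < ℓ) (hL : 0 ≤ L) {N : ℕ}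
    (P : ℝ → Prop) [DecidablePred P] (cl : ℝ → Prop) [DecidablePred cl]
    (h : ∀ i j : ℕ, i < N → j < N → i ≤ j → P (x₀ + i * w) → P (x₀ + j * w) →
      (cl (x₀ + i * w) ↔ cl (x₀ + j * w)) → ((j : ℝ) - i) * w ≤ ℓ → ((j : ℝ) - i) * w ≤ L) :
    ((((Finset.range N).filter fun i : ℕ => P (x₀ + i * w)).card : ℝ)) ≤
      (N * w / ℓ + 1) * (2 * (L / w + 1)) := by
  classical
  set S := (Finset.range N).filter fun i : ℕ => P (x₀ + i * w) with hS
  -- the piece index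
  set q : ℕ → ℕ := fun i => ⌊(i : ℝ) * w / ℓ⌋₊ with hq
  set Q : ℕ := ⌊(N : ℝ) * w / ℓ⌋₊ with hQ
  have hmaps : (S : Set ℕ).MapsTo q (Finset.range (Q + 1)) := by
    intro i hi
    rw [Finset.mem_coe, hS, Finset.mem_filter, Finset.mem_range] at hi
    rw [Finset.coe_range, Set.mem_Iio, Nat.lt_succ_iff]
    apply Nat.floor_le_floor
    have : (i : ℝ) ≤ N := by exact_mod_cast hi.1.le
    exact div_le_div_of_nonneg_right (mul_le_mul_of_nonneg_right this hw.le) hℓ.le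
  have hcard := Finset.card_eq_sum_card_fiberwise hmaps
  -- each fibre, split by colour, has diameter ≤ L
  have hfib : ∀ b : ℕ, (((S.filter fun i => q i = b).card : ℝ)) ≤ 2 * (L / w + 1) := by
    intro b
    have hsplit : (S.filter fun i => q i = b) =
        ((S.filter fun i => q i = b).filter fun i : ℕ => cl (x₀ + i * w)) ∪
          ((S.filter fun i => q i = b).filter fun i : ℕ => ¬ cl (x₀ + i * w)) := by
      rw [Finset.filter_union_filter_not_eq]
    -- common diameter argument
    have hdiam : ∀ (c : Prop) [Decidable c] (side : ℝ → Prop) [DecidablePred side],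
        (∀ x, side x ↔ (cl x ↔ c)) →
        ((((S.filter fun i => q i = b).filter fun i : ℕ => side (x₀ + i * w)).card : ℝ)) ≤ L / w + 1 := by
      intro c _ side _ hside
      have hset : ((S.filter fun i => q i = b).filter fun i : ℕ => side (x₀ + i * w)) =
          (Finset.range N).filter fun i : ℕ => P (x₀ + i * w) ∧ q i = b ∧ side (x₀ + i * w) := by
        ext i; simp [hS, Finset.mem_filter, and_assoc]
      rw [hset]
      -- express the predicate as a predicate of the point `x₀ + i w`
      have key : ∀ i j : ℕ, i < N → j < N → i ≤ j →
          (P (x₀ + i * w) ∧ q i = b ∧ side (x₀ + i * w)) →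
          (P (x₀ + j * w) ∧ q j = b ∧ side (x₀ + j * w)) → ((j : ℝ) - i) * w ≤ L := by
        intro i j hi hj hij hPi hPj
        refine h i j hi hj hij hPi.1 hPj.1 ?_ ?_
        · rw [hside] at hPi hPj
          tauto
        · -- same piece: |j w - i w| < ℓ
          have hqi : (q i : ℝ) ≤ (i : ℝ) * w / ℓ := Nat.floor_le (by positivity)
          have hqj : (j : ℝ) * w / ℓ < q j + 1 := Nat.lt_floor_add_one _
          have hqq : q i = q j := hPi.2.1.trans hPj.2.1.symm
          rw [hqq] at hqi
          have : (j : ℝ) * w / ℓ - (i : ℝ) * w / ℓ < 1 := by linarith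
          rw [← sub_div, div_lt_one hℓ] at this
          linarith
      -- now a direct diameter count over `range N`
      refine natCard_le_of_diam (div_nonneg hL hw.le) fun i hi j hj => ?_
      rw [Finset.mem_filter, Finset.mem_range] at hi hj
      rw [le_div_iff₀ hw]
      rcases le_total i j with hij | hij
      · exact key i j hi.1 hj.1 hij hi.2 hj.2
      · have := key j i hj.1 hi.1 hij hj.2 hi.2
        have h0 : ((j : ℝ) - i) * w ≤ 0 := mul_nonpos_of_nonpos_of_nonneg (by
          have : (j : ℝ) ≤ i := by exact_mod_cast hij
          linarith) hw.le
        linarith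
    have h1 := hdiam True (fun x => cl x) (fun x => by simp)
    have h2 := hdiam False (fun x => ¬ cl x) (fun x => by simp)
    rw [hsplit]
    calc ((((S.filter fun i => q i = b).filter fun i : ℕ => cl (x₀ + i * w)) ∪
          ((S.filter fun i => q i = b).filter fun i : ℕ => ¬ cl (x₀ + i * w))).card : ℝ)
        ≤ (((S.filter fun i => q i = b).filter fun i : ℕ => cl (x₀ + i * w)).card : ℝ) +
          (((S.filter fun i => q i = b).filter fun i : ℕ => ¬ cl (x₀ + i * w)).card : ℝ) := by
          exact_mod_cast Finset.card_union_le _ _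
      _ ≤ (L / w + 1) + (L / w + 1) := add_le_add h1 h2
      _ = 2 * (L / w + 1) := by ring
  calc (S.card : ℝ) = ∑ b ∈ Finset.range (Q + 1), (((S.filter fun i => q i = b).card : ℝ)) := by
        rw [hcard]; push_cast; rfl
    _ ≤ ∑ b ∈ Finset.range (Q + 1), 2 * (L / w + 1) := Finset.sum_le_sum fun b _ => hfib b
    _ = (Q + 1 : ℝ) * (2 * (L / w + 1)) := by rw [Finset.sum_const, Finset.card_range]; simp
    _ ≤ (N * w / ℓ + 1) * (2 * (L / w + 1)) := by
        apply mul_le_mul_of_nonneg_right _ (by positivity)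
        have : (Q : ℝ) ≤ N * w / ℓ := Nat.floor_le (by positivity)
        linarith

/-! ### Pairwise analytic lemmas -/

/-- If `λ ≤ |g'|` on `[x, y]` then `λ (y - x) ≤ |g y - g x|` (Darboux alternative + mean value
theorem). [folklore] -/
theorem mul_sub_le_abs_sub_of_le_abs_deriv {g g' : ℝ → ℝ} (hg : ∀ z, HasDerivAt g (g' z) z)
    {x y lam : ℝ} (hxy : x ≤ y) (hlam : 0 < lam) (h : ∀ z ∈ Icc x y, lam ≤ |g' z|) :
    lam * (y - x) ≤ |g y - g x| := by
  have hne : ∀ z ∈ Icc x y, g' z ≠ 0 := fun z hz h0 => by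
    have := h z hz; rw [h0, abs_zero] at this; linarith
  have hderiv : ∀ z ∈ Icc x y, HasDerivWithinAt g (g' z) (Icc x y) z :=
    fun z _ => (hg z).hasDerivWithinAt
  have hcont : ∀ f : ℝ → ℝ, (∀ z, HasDerivAt f (deriv f z) z) → ContinuousOn f (Icc x y) :=
    fun f hf z _ => (hf z).continuousAt.continuousWithinAt
  have hdg : ∀ z, HasDerivAt g (deriv g z) z := fun z => by rw [(hg z).deriv]; exact hg z
  rcases hasDerivWithinAt_forall_lt_or_forall_gt_of_forall_ne (convex_Icc x y) hderiv hne with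
    hneg | hpos
  · have hdn0 : ∀ z, HasDerivAt (fun t => -g t) (-g' z) z := fun z => (hg z).fun_neg
    have hdn : ∀ z, HasDerivAt (fun t => -g t) (deriv (fun t => -g t) z) z := fun z => by
      rw [(hdn0 z).deriv]; exact hdn0 z
    have h' : ∀ z ∈ interior (Icc x y), lam ≤ deriv (fun t => -g t) z := by
      intro z hz
      have hz' : z ∈ Icc x y := interior_subset hz
      rw [(hdn0 z).deriv]
      have h1 := h z hz'; have h2 := hneg z hz'
      rw [abs_of_neg h2] at h1; linarith
    have := (convex_Icc x y).mul_sub_le_image_sub_of_le_deriv (hcont _ hdn)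
      (fun z _ => (hdn z).differentiableAt.differentiableWithinAt) h' x (left_mem_Icc.2 hxy) y
      (right_mem_Icc.2 hxy) hxy
    rw [abs_sub_comm]
    exact this.trans (by rw [neg_sub_neg]; exact le_abs_self _)
  · have h' : ∀ z ∈ interior (Icc x y), lam ≤ deriv g z := by
      intro z hz
      have hz' : z ∈ Icc x y := interior_subset hz
      rw [(hg z).deriv]
      have h1 := h z hz'; have h2 := hpos z hz'
      rw [abs_of_pos h2] at h1; exact h1
    have := (convex_Icc x y).mul_sub_le_image_sub_of_le_deriv (hcont _ hdg)
      (fun z _ => (hdg z).differentiableAt.differentiableWithinAt) h' x (left_mem_Icc.2 hxy) y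
      (right_mem_Icc.2 hxy) hxy
    exact this.trans (le_abs_self _)

/-- Lipschitz bound from a derivative bound on an interval: `|g z - g x| ≤ M (z - x)` for
`z ∈ [x, y]` if `|g'| ≤ M` on `[x, y]`. [folklore] -/
theorem abs_sub_le_of_abs_deriv_le {g g' : ℝ → ℝ} (hg : ∀ z, HasDerivAt g (g' z) z)
    {x y M : ℝ} (h : ∀ z ∈ Icc x y, |g' z| ≤ M) {z : ℝ} (hz : z ∈ Icc x y) :
    |g z - g x| ≤ M * (z - x) := by
  have := (convex_Icc x y).norm_image_sub_le_of_norm_hasDerivWithin_le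
    (fun t _ => (hg t).hasDerivWithinAt) (fun t ht => by rw [Real.norm_eq_abs]; exact h t ht)
    (left_mem_Icc.2 (hz.1.trans hz.2)) hz
  rw [Real.norm_eq_abs, Real.norm_eq_abs, abs_of_nonneg (sub_nonneg.2 hz.1)] at this
  exact this

/-- Second-order lower bound to the right: `g'' ≥ c₂` on `[x, y]` gives
`g y ≥ g x + g' x (y - x) + (c₂/2)(y - x)²`. [folklore] -/
theorem quadratic_lower_right {g g' g'' : ℝ → ℝ} (hg : ∀ z, HasDerivAt g (g' z) z)
    (hg' : ∀ z, HasDerivAt g' (g'' z) z) {x y c₂ : ℝ} (hxy : x ≤ y)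
    (h : ∀ z ∈ Icc x y, c₂ ≤ g'' z) :
    g x + g' x * (y - x) + c₂ / 2 * (y - x) ^ 2 ≤ g y := by
  -- first `g' z ≥ g' x + c₂ (z - x)`
  have hd' : ∀ z, HasDerivAt g' (deriv g' z) z := fun z => by rw [(hg' z).deriv]; exact hg' z
  have step1 : ∀ z ∈ Icc x y, c₂ * (z - x) ≤ g' z - g' x := by
    intro z hz
    refine (convex_Icc x y).mul_sub_le_image_sub_of_le_deriv
      (fun t _ => (hd' t).continuousAt.continuousWithinAt)
      (fun t _ => (hd' t).differentiableAt.differentiableWithinAt)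
      (fun t ht => by rw [(hg' t).deriv]; exact h t (interior_subset ht)) x
      (left_mem_Icc.2 hxy) z hz hz.1
  have hφ' : ∀ t, HasDerivAt (fun t => g t - g' x * t - c₂ / 2 * ((t - x) * (t - x)))
      (g' t - g' x - c₂ * (t - x)) t := by
    intro t
    have h1 := ((hg t).fun_sub ((hasDerivAt_id' t).const_mul (g' x))).fun_sub
      ((((hasDerivAt_id' t).sub_const x).fun_mul ((hasDerivAt_id' t).sub_const x)).const_mul (c₂ / 2))
    exact h1.congr_deriv (by ring)
  have hmono := (convex_Icc x y).mul_sub_le_image_sub_of_le_deriv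
    (f := fun t => g t - g' x * t - c₂ / 2 * ((t - x) * (t - x))) (C := 0)
    (fun t _ => (hφ' t).continuousAt.continuousWithinAt)
    (fun t _ => (hφ' t).differentiableAt.differentiableWithinAt)
    (fun t ht => by
      rw [(hφ' t).deriv]
      have := step1 t (interior_subset ht); linarith) x (left_mem_Icc.2 hxy) y
    (right_mem_Icc.2 hxy) hxy
  simp only [zero_mul] at hmono
  nlinarith [hmono]

/-- Second-order lower bound to the left: `g'' ≥ c₂` on `[x, y]` gives
`g x ≥ g y + g' y (x - y) + (c₂/2)(x - y)²`. [folklore] -/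
theorem quadratic_lower_left {g g' g'' : ℝ → ℝ} (hg : ∀ z, HasDerivAt g (g' z) z)
    (hg' : ∀ z, HasDerivAt g' (g'' z) z) {x y c₂ : ℝ} (hxy : x ≤ y)
    (h : ∀ z ∈ Icc x y, c₂ ≤ g'' z) :
    g y + g' y * (x - y) + c₂ / 2 * (x - y) ^ 2 ≤ g x := by
  have hd' : ∀ z, HasDerivAt g' (deriv g' z) z := fun z => by rw [(hg' z).deriv]; exact hg' z
  have step1 : ∀ z ∈ Icc x y, c₂ * (y - z) ≤ g' y - g' z := by
    intro z hz
    refine (convex_Icc x y).mul_sub_le_image_sub_of_le_deriv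
      (fun t _ => (hd' t).continuousAt.continuousWithinAt)
      (fun t _ => (hd' t).differentiableAt.differentiableWithinAt)
      (fun t ht => by rw [(hg' t).deriv]; exact h t (interior_subset ht)) z hz y
      (right_mem_Icc.2 hxy) hz.2
  have hψ' : ∀ t, HasDerivAt (fun t => g t - g' y * t - c₂ / 2 * ((t - y) * (t - y)))
      (g' t - g' y - c₂ * (t - y)) t := by
    intro t
    have h1 := ((hg t).fun_sub ((hasDerivAt_id' t).const_mul (g' y))).fun_sub
      ((((hasDerivAt_id' t).sub_const y).fun_mul ((hasDerivAt_id' t).sub_const y)).const_mul (c₂ / 2))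
    exact h1.congr_deriv (by ring)
  have hanti := (convex_Icc x y).image_sub_le_mul_sub_of_deriv_le
    (f := fun t => g t - g' y * t - c₂ / 2 * ((t - y) * (t - y))) (C := 0)
    (fun t _ => (hψ' t).continuousAt.continuousWithinAt)
    (fun t _ => (hψ' t).differentiableAt.differentiableWithinAt)
    (fun t ht => by
      rw [(hψ' t).deriv]
      have := step1 t (interior_subset ht); linarith) x (left_mem_Icc.2 hxy) y
    (right_mem_Icc.2 hxy) hxy
  simp only [zero_mul] at hanti
  nlinarith [hanti]

/-! ### The four pairwise closeness lemmas -/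

/-- (L2) Two points of `{|g| ≤ δ, |g'| ≥ λ}` within `λ/(2A)` of each other (`g'` `A`-Lipschitz)
are within `4δ/λ`. [folklore] -/
theorem pair_close_L2 {g g' : ℝ → ℝ} (hg : ∀ z, HasDerivAt g (g' z) z) {A lam δ : ℝ}
    (hA : 0 < A) (hlam : 0 < lam)
    (hlip : ∀ z z', |g' z - g' z'| ≤ A * |z - z'|)
    {x y : ℝ} (hxy : x ≤ y) (hx : |g x| ≤ δ ∧ lam ≤ |g' x|) (hy : |g y| ≤ δ ∧ lam ≤ |g' y|)
    (hclose : y - x ≤ lam / (2 * A)) : y - x ≤ 4 * δ / lam := by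
  have hder : ∀ z ∈ Icc x y, lam / 2 ≤ |g' z| := by
    intro z hz
    have h1 := hlip x z
    rw [abs_of_nonpos (by linarith [hz.1] : x - z ≤ 0)] at h1
    have h2 : A * (z - x) ≤ lam / 2 := by
      calc A * (z - x) ≤ A * (lam / (2 * A)) := by
            exact mul_le_mul_of_nonneg_left (by linarith [hz.2]) hA.le
        _ = lam / 2 := by field_simp
    have := abs_sub_abs_le_abs_sub (g' x) (g' z)
    linarith [hx.2]
  have h := mul_sub_le_abs_sub_of_le_abs_deriv hg hxy (by linarith) hder
  have h2 : |g y - g x| ≤ 2 * δ := by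
    calc |g y - g x| ≤ |g y| + |g x| := abs_sub _ _
      _ ≤ 2 * δ := by linarith [hx.1, hy.1]
  rw [le_div_iff₀ hlam]; nlinarith

/-- (L3) Transversality `|g| ≤ η₀ ⇒ |g'| ≥ λ` with `|g'| ≤ M₁`: two points of `{|g| ≤ δ}`,
`δ ≤ η₀/2`, within `η₀/(2M₁)` are within `2δ/λ`. [folklore] -/
theorem pair_close_L3 {g g' : ℝ → ℝ} (hg : ∀ z, HasDerivAt g (g' z) z) {M₁ lam η₀ δ : ℝ}
    (hM : 0 < M₁) (hlam : 0 < lam) (hδη : δ ≤ η₀ / 2)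
    (hbd : ∀ z, |g' z| ≤ M₁) (htrans : ∀ z, |g z| ≤ η₀ → lam ≤ |g' z|)
    {x y : ℝ} (hxy : x ≤ y) (hx : |g x| ≤ δ) (hy : |g y| ≤ δ)
    (hclose : y - x ≤ η₀ / (2 * M₁)) : y - x ≤ 2 * δ / lam := by
  have hder : ∀ z ∈ Icc x y, lam ≤ |g' z| := by
    intro z hz
    apply htrans
    have h1 := abs_sub_le_of_abs_deriv_le hg (fun t _ => hbd t) hz
    have h2 : M₁ * (z - x) ≤ η₀ / 2 := by
      calc M₁ * (z - x) ≤ M₁ * (η₀ / (2 * M₁)) := mul_le_mul_of_nonneg_left (by linarith [hz.2]) hM.le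
        _ = η₀ / 2 := by field_simp
    have := abs_sub_abs_le_abs_sub (g z) (g x)
    linarith
  have h := mul_sub_le_abs_sub_of_le_abs_deriv hg hxy hlam hder
  have h2 : |g y - g x| ≤ 2 * δ := by
    calc |g y - g x| ≤ |g y| + |g x| := abs_sub _ _
      _ ≤ 2 * δ := by linarith
  rw [le_div_iff₀ hlam]; nlinarith

/-- (L4) Stratified non-degeneracy `|g| ≤ η₀ ⇒ |g'| ≤ η₁ ⇒ g'' ≥ c₂`, with `|g'| ≤ M₁`,
`|g''| ≤ A`: two points of `{|g| ≤ δ}` (`δ ≤ η₀/2`) within `min(η₀/(2M₁), η₁/(4A))` and with the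
same sign of `g'` are within `max(8δ/η₁, 2√(δ/c₂))`. [folklore] -/
theorem pair_close_L4 {g g' g'' : ℝ → ℝ} (hg : ∀ z, HasDerivAt g (g' z) z)
    (hg' : ∀ z, HasDerivAt g' (g'' z) z) {M₁ A η₀ η₁ c₂ δ : ℝ}
    (hM : 0 < M₁) (hA : 0 < A) (hη₁ : 0 < η₁) (hc₂ : 0 < c₂) (hδη : δ ≤ η₀ / 2)
    (hbd1 : ∀ z, |g' z| ≤ M₁) (hbd2 : ∀ z, |g'' z| ≤ A)
    (hstrat : ∀ z, |g z| ≤ η₀ → |g' z| ≤ η₁ → c₂ ≤ g'' z)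
    {x y : ℝ} (hxy : x ≤ y) (hx : |g x| ≤ δ) (hy : |g y| ≤ δ) (hcl : (0 ≤ g' x ↔ 0 ≤ g' y))
    (hclose : y - x ≤ min (η₀ / (2 * M₁)) (η₁ / (4 * A))) :
    y - x ≤ max (8 * δ / η₁) (2 * Real.sqrt (δ / c₂)) := by
  have hc1 : y - x ≤ η₀ / (2 * M₁) := hclose.trans (min_le_left _ _)
  have hc2 : y - x ≤ η₁ / (4 * A) := hclose.trans (min_le_right _ _)
  -- `g'` is `A`-Lipschitz on `[x, y]`, `g` is within `η₀`
  have hlipg' : ∀ z ∈ Icc x y, |g' z - g' x| ≤ η₁ / 4 := by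
    intro z hz
    have h1 := abs_sub_le_of_abs_deriv_le hg' (fun t _ => hbd2 t) hz
    calc |g' z - g' x| ≤ A * (z - x) := h1
      _ ≤ A * (η₁ / (4 * A)) := mul_le_mul_of_nonneg_left (by linarith [hz.2]) hA.le
      _ = η₁ / 4 := by field_simp
  have hlipg'y : ∀ z ∈ Icc x y, |g' y - g' z| ≤ η₁ / 4 := by
    intro z hz
    have h1 := abs_sub_le_of_abs_deriv_le hg' (fun t _ => hbd2 t) (x := z) (y := y)
      (z := y) ⟨hz.2, le_rfl⟩
    calc |g' y - g' z| ≤ A * (y - z) := h1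
      _ ≤ A * (η₁ / (4 * A)) := mul_le_mul_of_nonneg_left (by linarith [hz.1]) hA.le
      _ = η₁ / 4 := by field_simp
  have hgin : ∀ z ∈ Icc x y, |g z| ≤ η₀ := by
    intro z hz
    have h1 := abs_sub_le_of_abs_deriv_le hg (fun t _ => hbd1 t) hz
    have h2 : M₁ * (z - x) ≤ η₀ / 2 := by
      calc M₁ * (z - x) ≤ M₁ * (η₀ / (2 * M₁)) := mul_le_mul_of_nonneg_left (by linarith [hz.2]) hM.le
        _ = η₀ / 2 := by field_simp
    have := abs_sub_abs_le_abs_sub (g z) (g x)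
    linarith
  have h2δ : |g y - g x| ≤ 2 * δ := by
    calc |g y - g x| ≤ |g y| + |g x| := abs_sub _ _
      _ ≤ 2 * δ := by linarith
  by_cases hbig : η₁ / 2 ≤ |g' x| ∨ η₁ / 2 ≤ |g' y|
  · -- transversal piece
    have hder : ∀ z ∈ Icc x y, η₁ / 4 ≤ |g' z| := by
      intro z hz
      rcases hbig with hb | hb
      · have := abs_sub_abs_le_abs_sub (g' x) (g' z)
        have h1 := hlipg' z hz
        rw [abs_sub_comm] at h1
        linarith
      · have := abs_sub_abs_le_abs_sub (g' y) (g' z)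
        have h1 := hlipg'y z hz
        linarith
    have h := mul_sub_le_abs_sub_of_le_abs_deriv hg hxy (by positivity) hder
    refine le_trans ?_ (le_max_left _ _)
    rw [le_div_iff₀ hη₁]; nlinarith
  · push Not at hbig
    -- convex piece
    have hconv : ∀ z ∈ Icc x y, c₂ ≤ g'' z := by
      intro z hz
      refine hstrat z (hgin z hz) ?_
      have := abs_sub_abs_le_abs_sub (g' z) (g' x)
      have h1 := hlipg' z hz
      linarith [hbig.1]
    refine le_trans ?_ (le_max_right _ _)
    have hsq : (y - x) ^ 2 ≤ 4 * δ / c₂ := by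
      rw [le_div_iff₀ hc₂]
      rcases le_or_gt 0 (g' x) with hpos | hneg
      · have := quadratic_lower_right hg hg' hxy hconv
        have hgy : g y ≤ δ := (abs_le.1 hy).2
        have hgx : -δ ≤ g x := (abs_le.1 hx).1
        nlinarith [mul_nonneg hpos (sub_nonneg.2 hxy)]
      · have hneg' : g' y < 0 := by
          by_contra hh; push Not at hh; exact absurd (hcl.2 hh) (not_le.2 hneg)
        have := quadratic_lower_left hg hg' hxy hconv
        have hgx : g x ≤ δ := (abs_le.1 hx).2
        have hgy : -δ ≤ g y := (abs_le.1 hy).1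
        have : 0 ≤ g' y * (x - y) := mul_nonneg_of_nonpos_of_nonpos hneg'.le (by linarith)
        nlinarith
    have h0 : 0 ≤ y - x := sub_nonneg.2 hxy
    calc y - x = Real.sqrt ((y - x) ^ 2) := by rw [Real.sqrt_sq h0]
      _ ≤ Real.sqrt (4 * δ / c₂) := Real.sqrt_le_sqrt hsq
      _ = 2 * Real.sqrt (δ / c₂) := by
          rw [show (4 : ℝ) * δ / c₂ = 2 ^ 2 * (δ / c₂) by ring, Real.sqrt_mul (by norm_num),
            Real.sqrt_sq (by norm_num)]

/-- (L5) The fold-in-`t` closeness: with `|F'(t)| ≤ M t`, `G` `M_G`-Lipschitz and the key lower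
bound `c t ≤ |F' t|` on `{0 < t ≤ τ, |F| ≤ η₀, |G| ≤ 4λ}`, two points `0 < t₁ ≤ t₂ ≤ τ` of
`{|F| ≤ δ, |G| ≤ 2λ}` within `min(η₀/(2Mτ), 2λ/M_G)` are within `2√(δ/c)`, and within
`2δ√(2M)/(c√|F 0|)` when `|F 0| > 2δ`. [folklore] -/
theorem pair_close_L5 {F F' G : ℝ → ℝ} (hF : ∀ t, HasDerivAt F (F' t) t)
    {M MG c lam η₀ τ δ : ℝ} (hM : 0 < M) (hMG : 0 < MG) (hc : 0 < c) (hlam : 0 < lam)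
    (hτ : 0 < τ) (hδ : 0 ≤ δ) (hδη : δ ≤ η₀ / 2)
    (hF'bd : ∀ t, |F' t| ≤ M * |t|) (hG : ∀ t t', |G t - G t'| ≤ MG * |t - t'|)
    (hkey : ∀ t, 0 < t → t ≤ τ → |F t| ≤ η₀ → |G t| ≤ 4 * lam → c * t ≤ |F' t|)
    {t₁ t₂ : ℝ} (h0 : 0 < t₁) (h12 : t₁ ≤ t₂) (h2τ : t₂ ≤ τ)
    (h1 : |F t₁| ≤ δ ∧ |G t₁| ≤ 2 * lam) (h2 : |F t₂| ≤ δ ∧ |G t₂| ≤ 2 * lam)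
    (hclose : t₂ - t₁ ≤ min (η₀ / (2 * M * τ)) (2 * lam / MG)) :
    t₂ - t₁ ≤ (if |F 0| ≤ 2 * δ then 2 * Real.sqrt (δ / c)
      else 2 * δ * Real.sqrt (2 * M) / (c * Real.sqrt |F 0|)) := by
  have hc1 : t₂ - t₁ ≤ η₀ / (2 * M * τ) := hclose.trans (min_le_left _ _)
  have hc2 : t₂ - t₁ ≤ 2 * lam / MG := hclose.trans (min_le_right _ _)
  -- on `[t₁, t₂]` the key bound applies
  have hin : ∀ z ∈ Icc t₁ t₂, c * z ≤ |F' z| := by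
    intro z hz
    have hz0 : 0 < z := h0.trans_le hz.1
    have hzτ : z ≤ τ := hz.2.trans h2τ
    refine hkey z hz0 hzτ ?_ ?_
    · have hbd : ∀ s ∈ Icc t₁ t₂, |F' s| ≤ M * τ := fun s hs =>
        (hF'bd s).trans (by rw [abs_of_pos (h0.trans_le hs.1)]; exact mul_le_mul_of_nonneg_left (hs.2.trans h2τ) hM.le)
      have h1' := abs_sub_le_of_abs_deriv_le hF hbd hz
      have h2' : M * τ * (z - t₁) ≤ η₀ / 2 := by
        calc M * τ * (z - t₁) ≤ M * τ * (η₀ / (2 * M * τ)) :=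
              mul_le_mul_of_nonneg_left (by linarith [hz.2]) (by positivity)
          _ = η₀ / 2 := by field_simp
      have := abs_sub_abs_le_abs_sub (F z) (F t₁)
      linarith [h1.1]
    · have h1' := hG z t₁
      rw [abs_of_nonneg (sub_nonneg.2 hz.1)] at h1'
      have h2' : MG * (z - t₁) ≤ 2 * lam := by
        calc MG * (z - t₁) ≤ MG * (2 * lam / MG) := mul_le_mul_of_nonneg_left (by linarith [hz.2]) hMG.le
          _ = 2 * lam := by field_simp
      have := abs_sub_abs_le_abs_sub (G z) (G t₁)
      linarith [h1.2]
  -- hence `F'` has a sign on `[t₁, t₂]` and `|F t₂ - F t₁| ≥ (c/2)(t₂² - t₁²)`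
  have hne : ∀ z ∈ Icc t₁ t₂, F' z ≠ 0 := fun z hz h0' => by
    have := hin z hz; rw [h0', abs_zero] at this
    have : 0 < c * z := mul_pos hc (h0.trans_le hz.1)
    linarith
  have hD : c / 2 * (t₂ ^ 2 - t₁ ^ 2) ≤ |F t₂ - F t₁| := by
    rcases hasDerivWithinAt_forall_lt_or_forall_gt_of_forall_ne (convex_Icc t₁ t₂)
      (fun z _ => (hF z).hasDerivWithinAt) hne with hneg | hpos
    · -- decreasing: use `φ = -F - c t²/2`
      have hφ' : ∀ t, HasDerivAt (fun t => -F t - c / 2 * (t * t)) (-F' t - c * t) t := by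
        intro t
        have := ((hF t).fun_neg).fun_sub (((hasDerivAt_id' t).fun_mul (hasDerivAt_id' t)).const_mul (c / 2))
        exact this.congr_deriv (by ring)
      have hmono := (convex_Icc t₁ t₂).mul_sub_le_image_sub_of_le_deriv
        (f := fun t => -F t - c / 2 * (t * t)) (C := 0)
        (fun t _ => (hφ' t).continuousAt.continuousWithinAt)
        (fun t _ => (hφ' t).differentiableAt.differentiableWithinAt)
        (fun t ht => by
          rw [(hφ' t).deriv]
          have ht' := interior_subset ht
          have h1' := hin t ht'; have h2' := hneg t ht'
          rw [abs_of_neg h2'] at h1'; linarith) t₁ (left_mem_Icc.2 h12) t₂ (right_mem_Icc.2 h12) h12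
      simp only [zero_mul] at hmono
      rw [abs_sub_comm]
      calc c / 2 * (t₂ ^ 2 - t₁ ^ 2) ≤ F t₁ - F t₂ := by linarith
        _ ≤ |F t₁ - F t₂| := le_abs_self _
    · have hφ' : ∀ t, HasDerivAt (fun t => F t - c / 2 * (t * t)) (F' t - c * t) t := by
        intro t
        have := (hF t).fun_sub (((hasDerivAt_id' t).fun_mul (hasDerivAt_id' t)).const_mul (c / 2))
        exact this.congr_deriv (by ring)
      have hmono := (convex_Icc t₁ t₂).mul_sub_le_image_sub_of_le_deriv
        (f := fun t => F t - c / 2 * (t * t)) (C := 0)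
        (fun t _ => (hφ' t).continuousAt.continuousWithinAt)
        (fun t _ => (hφ' t).differentiableAt.differentiableWithinAt)
        (fun t ht => by
          rw [(hφ' t).deriv]
          have ht' := interior_subset ht
          have h1' := hin t ht'; have h2' := hpos t ht'
          rw [abs_of_pos h2'] at h1'; linarith) t₁ (left_mem_Icc.2 h12) t₂ (right_mem_Icc.2 h12) h12
      simp only [zero_mul] at hmono
      calc c / 2 * (t₂ ^ 2 - t₁ ^ 2) ≤ F t₂ - F t₁ := by linarith
        _ ≤ |F t₂ - F t₁| := le_abs_self _
  have h2δ : |F t₂ - F t₁| ≤ 2 * δ := by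
    calc |F t₂ - F t₁| ≤ |F t₂| + |F t₁| := abs_sub _ _
      _ ≤ 2 * δ := by linarith [h1.1, h2.1]
  have hDle : t₂ ^ 2 - t₁ ^ 2 ≤ 4 * δ / c := by
    rw [le_div_iff₀ hc]; nlinarith
  have hdiff0 : 0 ≤ t₂ - t₁ := sub_nonneg.2 h12
  -- the square-root bound
  have hsqrt : t₂ - t₁ ≤ 2 * Real.sqrt (δ / c) := by
    have hsq : (t₂ - t₁) ^ 2 ≤ 4 * δ / c := by nlinarith
    calc t₂ - t₁ = Real.sqrt ((t₂ - t₁) ^ 2) := by rw [Real.sqrt_sq hdiff0]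
      _ ≤ Real.sqrt (4 * δ / c) := Real.sqrt_le_sqrt hsq
      _ = 2 * Real.sqrt (δ / c) := by
          rw [show (4 : ℝ) * δ / c = 2 ^ 2 * (δ / c) by ring, Real.sqrt_mul (by norm_num),
            Real.sqrt_sq (by norm_num)]
  split_ifs with hF0
  · exact hsqrt
  · push Not at hF0
    -- depth: `|F t₁ - F 0| ≤ M t₁²`, so `t₁ ≥ √(|F 0|/(2M))`
    have hdepth : |F t₁ - F 0| ≤ M * t₁ ^ 2 := by
      have hbd : ∀ s ∈ Icc 0 t₁, |F' s| ≤ M * t₁ := fun s hs =>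
        (hF'bd s).trans (by rw [abs_of_nonneg hs.1]; exact mul_le_mul_of_nonneg_left hs.2 hM.le)
      have := abs_sub_le_of_abs_deriv_le hF hbd (z := t₁) ⟨h0.le, le_rfl⟩
      calc |F t₁ - F 0| ≤ M * t₁ * (t₁ - 0) := this
        _ = M * t₁ ^ 2 := by ring
    have ht₁sq : |F 0| / (2 * M) ≤ t₁ ^ 2 := by
      rw [div_le_iff₀ (by positivity)]
      have := abs_sub_abs_le_abs_sub (F 0) (F t₁)
      rw [abs_sub_comm] at hdepth
      nlinarith [h1.1]
    have hF0pos : 0 < |F 0| := by linarith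
    have ht₁ge : Real.sqrt |F 0| / Real.sqrt (2 * M) ≤ t₁ := by
      rw [← Real.sqrt_div (abs_nonneg _)]
      calc Real.sqrt (|F 0| / (2 * M)) ≤ Real.sqrt (t₁ ^ 2) := Real.sqrt_le_sqrt ht₁sq
        _ = t₁ := Real.sqrt_sq h0.le
    -- `t₂ - t₁ ≤ (4δ/c)/(t₁ + t₂) ≤ 2δ/(c t₁)`
    have hlin : t₂ - t₁ ≤ 2 * δ / (c * t₁) := by
      rw [le_div_iff₀ (by positivity)]
      have : (t₂ - t₁) * (2 * t₁) ≤ (t₂ - t₁) * (t₂ + t₁) := by nlinarith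
      nlinarith
    have hsM : 0 < Real.sqrt (2 * M) := Real.sqrt_pos.2 (by positivity)
    have hsF : 0 < Real.sqrt |F 0| := Real.sqrt_pos.2 hF0pos
    calc t₂ - t₁ ≤ 2 * δ / (c * t₁) := hlin
      _ ≤ 2 * δ / (c * (Real.sqrt |F 0| / Real.sqrt (2 * M))) := by
          apply div_le_div_of_nonneg_left (by positivity) (by positivity)
          exact mul_le_mul_of_nonneg_left ht₁ge hc.le
      _ = 2 * δ * Real.sqrt (2 * M) / (c * Real.sqrt |F 0|) := by
          field_simp

/-! ### The grid counts -/

/-- (L2 count) `#{i < N : |g(xᵢ)| ≤ δ, |g'(xᵢ)| ≥ λ} ≤ (2ANw/λ + 1)·2(4δ/(λw) + 1)`. [folklore] -/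
theorem gridCount_L2 {g g' : ℝ → ℝ} (hg : ∀ z, HasDerivAt g (g' z) z) {A lam δ : ℝ}
    (hA : 0 < A) (hlam : 0 < lam) (hδ : 0 ≤ δ) (hlip : ∀ z z', |g' z - g' z'| ≤ A * |z - z'|)
    {x₀ w : ℝ} (hw : 0 < w) (N : ℕ) :
    ((((Finset.range N).filter fun i : ℕ =>
        |g (x₀ + i * w)| ≤ δ ∧ lam ≤ |g' (x₀ + i * w)|).card : ℝ)) ≤
      (N * w / (lam / (2 * A)) + 1) * (2 * ((4 * δ / lam) / w + 1)) := by
  classical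
  refine gridCard_le_chop hw (by positivity) (by positivity)
    (fun x => |g x| ≤ δ ∧ lam ≤ |g' x|) (fun _ => True) fun i j hi hj hij hPi hPj _ hclose => ?_
  have hxy : x₀ + i * w ≤ x₀ + j * w := by
    have : (i : ℝ) ≤ j := by exact_mod_cast hij
    nlinarith
  have := pair_close_L2 hg hA hlam hlip hxy hPi hPj (by linarith)
  linarith

/-- (L3 count) transversality `|g| ≤ η₀ ⇒ |g'| ≥ λ`, `|g'| ≤ M₁`, `δ ≤ η₀/2`:
`#{i < N : |g(xᵢ)| ≤ δ} ≤ (2M₁Nw/η₀ + 1)·2(2δ/(λw) + 1)`. [folklore] -/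
theorem gridCount_L3 {g g' : ℝ → ℝ} (hg : ∀ z, HasDerivAt g (g' z) z) {M₁ lam η₀ δ : ℝ}
    (hM : 0 < M₁) (hlam : 0 < lam) (hη₀ : 0 < η₀) (hδ : 0 ≤ δ) (hδη : δ ≤ η₀ / 2)
    (hbd : ∀ z, |g' z| ≤ M₁) (htrans : ∀ z, |g z| ≤ η₀ → lam ≤ |g' z|)
    {x₀ w : ℝ} (hw : 0 < w) (N : ℕ) :
    ((((Finset.range N).filter fun i : ℕ => |g (x₀ + i * w)| ≤ δ).card : ℝ)) ≤
      (N * w / (η₀ / (2 * M₁)) + 1) * (2 * ((2 * δ / lam) / w + 1)) := by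
  classical
  refine gridCard_le_chop hw (by positivity) (by positivity)
    (fun x => |g x| ≤ δ) (fun _ => True) fun i j hi hj hij hPi hPj _ hclose => ?_
  have hxy : x₀ + i * w ≤ x₀ + j * w := by
    have : (i : ℝ) ≤ j := by exact_mod_cast hij
    nlinarith
  have := pair_close_L3 hg hM hlam hδη hbd htrans hxy hPi hPj (by linarith)
  linarith

/-- (L4 count) stratified non-degeneracy: `#{i < N : |g(xᵢ)| ≤ δ} ≤
(Nw/ℓ + 1)·2(max(8δ/η₁, 2√(δ/c₂))/w + 1)`, `ℓ = min(η₀/(2M₁), η₁/(4A))`. [folklore] -/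
theorem gridCount_L4 {g g' g'' : ℝ → ℝ} (hg : ∀ z, HasDerivAt g (g' z) z)
    (hg' : ∀ z, HasDerivAt g' (g'' z) z) {M₁ A η₀ η₁ c₂ δ : ℝ}
    (hM : 0 < M₁) (hA : 0 < A) (hη₀ : 0 < η₀) (hη₁ : 0 < η₁) (hc₂ : 0 < c₂) (hδ : 0 ≤ δ)
    (hδη : δ ≤ η₀ / 2) (hbd1 : ∀ z, |g' z| ≤ M₁) (hbd2 : ∀ z, |g'' z| ≤ A)
    (hstrat : ∀ z, |g z| ≤ η₀ → |g' z| ≤ η₁ → c₂ ≤ g'' z)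
    {x₀ w : ℝ} (hw : 0 < w) (N : ℕ) :
    ((((Finset.range N).filter fun i : ℕ => |g (x₀ + i * w)| ≤ δ).card : ℝ)) ≤
      (N * w / min (η₀ / (2 * M₁)) (η₁ / (4 * A)) + 1) *
        (2 * (max (8 * δ / η₁) (2 * Real.sqrt (δ / c₂)) / w + 1)) := by
  classical
  refine gridCard_le_chop hw (lt_min (by positivity) (by positivity)) (by positivity)
    (fun x => |g x| ≤ δ) (fun x => 0 ≤ g' x) fun i j hi hj hij hPi hPj hcl hclose => ?_
  have hxy : x₀ + i * w ≤ x₀ + j * w := by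
    have : (i : ℝ) ≤ j := by exact_mod_cast hij
    nlinarith
  have := pair_close_L4 hg hg' hM hA hη₁ hc₂ hδη hbd1 hbd2 hstrat hxy hPi hPj hcl (by linarith)
  linarith

/-- (L5 count) the fold-in-`t` count on the grid `t = (i+1) w`, `i < K₀`, `K₀ w ≤ τ`. [folklore] -/
theorem gridCount_L5 {F F' G : ℝ → ℝ} (hF : ∀ t, HasDerivAt F (F' t) t)
    {M MG c lam η₀ τ δ : ℝ} (hM : 0 < M) (hMG : 0 < MG) (hc : 0 < c) (hlam : 0 < lam)
    (hτ : 0 < τ) (hη₀ : 0 < η₀) (hδ : 0 ≤ δ) (hδη : δ ≤ η₀ / 2)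
    (hF'bd : ∀ t, |F' t| ≤ M * |t|) (hG : ∀ t t', |G t - G t'| ≤ MG * |t - t'|)
    (hkey : ∀ t, 0 < t → t ≤ τ → |F t| ≤ η₀ → |G t| ≤ 4 * lam → c * t ≤ |F' t|)
    {w : ℝ} (hw : 0 < w) {K₀ : ℕ} (hK : (K₀ : ℝ) * w ≤ τ) :
    ((((Finset.range K₀).filter fun i : ℕ =>
        |F (w + i * w)| ≤ δ ∧ |G (w + i * w)| ≤ 2 * lam).card : ℝ)) ≤
      (K₀ * w / min (η₀ / (2 * M * τ)) (2 * lam / MG) + 1) *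
        (2 * ((if |F 0| ≤ 2 * δ then 2 * Real.sqrt (δ / c)
          else 2 * δ * Real.sqrt (2 * M) / (c * Real.sqrt |F 0|)) / w + 1)) := by
  classical
  have hL : 0 ≤ (if |F 0| ≤ 2 * δ then 2 * Real.sqrt (δ / c)
      else 2 * δ * Real.sqrt (2 * M) / (c * Real.sqrt |F 0|)) := by
    split_ifs <;> positivity
  refine gridCard_le_chop hw (lt_min (by positivity) (by positivity)) hL
    (fun t => |F t| ≤ δ ∧ |G t| ≤ 2 * lam) (fun _ => True)
    fun i j hi hj hij hPi hPj _ hclose => ?_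
  have hij' : (i : ℝ) ≤ j := by exact_mod_cast hij
  have h0 : 0 < w + i * w := by positivity
  have h12 : w + i * w ≤ w + j * w := by nlinarith
  have h2τ : w + j * w ≤ τ := by
    have : (j : ℝ) + 1 ≤ K₀ := by exact_mod_cast Nat.succ_le_of_lt hj
    nlinarith
  have := pair_close_L5 hF hM hMG hc hlam hτ hδ hδη hF'bd hG hkey h0 h12 h2τ hPi hPj (by linarith)
  linarith

/-! ### Periodicity and parity of the curve data -/

section Level

variable {μ : ℝ} (hμ₁ : -4 < μ) (hμ₂ : μ < 0)
include hμ₁ hμ₂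

/-- `u'` is `2π`-periodic. [folklore] -/
theorem bandFermiRadiusDeriv_add_int_mul_two_pi (θ : ℝ) (m : ℤ) :
    bandFermiRadiusDeriv μ (θ + m * (2 * π)) = bandFermiRadiusDeriv μ θ := by
  unfold bandFermiRadiusDeriv rayDispersionDθ rayDispersionDt
  rw [bandFermiRadius_add_int_mul_two_pi hμ₁ hμ₂, Real.cos_add_int_mul_two_pi, Real.sin_add_int_mul_two_pi]

/-- `X, Y, X', Y'` are `2π`-periodic. [folklore] -/
theorem band_add_int_mul_two_pi (θ : ℝ) (m : ℤ) :
    bandX μ (θ + m * (2 * π)) = bandX μ θ ∧ bandY μ (θ + m * (2 * π)) = bandY μ θ ∧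
    bandVX μ (θ + m * (2 * π)) = bandVX μ θ ∧ bandVY μ (θ + m * (2 * π)) = bandVY μ θ := by
  simp only [bandX, bandY, bandVX, bandVY, bandFermiRadius_add_int_mul_two_pi hμ₁ hμ₂,
    bandFermiRadiusDeriv_add_int_mul_two_pi hμ₁ hμ₂, Real.cos_add_int_mul_two_pi, Real.sin_add_int_mul_two_pi]
  exact ⟨trivial, trivial, trivial, trivial⟩

/-- `X, Y, X', Y'` change sign under `θ ↦ θ + π`. [folklore] -/
theorem band_add_pi (θ : ℝ) :
    bandX μ (θ + π) = -bandX μ θ ∧ bandY μ (θ + π) = -bandY μ θ ∧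
    bandVX μ (θ + π) = -bandVX μ θ ∧ bandVY μ (θ + π) = -bandVY μ θ := by
  simp only [bandX, bandY, bandVX, bandVY, bandFermiRadius_add_pi hμ₁ hμ₂,
    bandFermiRadiusDeriv_add_pi hμ₁ hμ₂, Real.cos_add_pi, Real.sin_add_pi]
  refine ⟨by ring, by ring, by ring, by ring⟩

/-- **Parity**: `p(θ + jπ) = σ p(θ)`, `p'(θ + jπ) = σ p'(θ)` with `σ = ±1`. [folklore] -/
theorem band_add_int_mul_pi (θ : ℝ) (j : ℤ) : ∃ σ : ℝ, (σ = 1 ∨ σ = -1) ∧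
    bandX μ (θ + j * π) = σ * bandX μ θ ∧ bandY μ (θ + j * π) = σ * bandY μ θ ∧
    bandVX μ (θ + j * π) = σ * bandVX μ θ ∧ bandVY μ (θ + j * π) = σ * bandVY μ θ := by
  rcases Int.even_or_odd' j with ⟨l, rfl | rfl⟩
  · refine ⟨1, Or.inl rfl, ?_⟩
    have h := band_add_int_mul_two_pi hμ₁ hμ₂ θ l
    push_cast
    rw [show θ + 2 * (l : ℝ) * π = θ + l * (2 * π) by ring]
    simpa using h
  · refine ⟨-1, Or.inr rfl, ?_⟩
    have h1 := band_add_int_mul_two_pi hμ₁ hμ₂ (θ + π) l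
    have h2 := band_add_pi hμ₁ hμ₂ θ
    push_cast
    rw [show θ + (2 * (l : ℝ) + 1) * π = θ + π + l * (2 * π) by ring]
    refine ⟨?_, ?_, ?_, ?_⟩
    · rw [h1.1, h2.1]; ring
    · rw [h1.2.1, h2.2.1]; ring
    · rw [h1.2.2.1, h2.2.2.1]; ring
    · rw [h1.2.2.2, h2.2.2.2]; ring

/-- The second-order identity `sin x · x'' + sin y · y'' = -(cos x x'² + cos y y'²)`. [folklore] -/
theorem sin_mul_acc_eq_neg_hess (θ : ℝ) :
    Real.sin (bandX μ θ) * bandAX μ θ + Real.sin (bandY μ θ) * bandAY μ θ =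
      -(Real.cos (bandX μ θ) * bandVX μ θ ^ 2 + Real.cos (bandY μ θ) * bandVY μ θ ^ 2) := by
  have := bandHess_add_grad_dot_acc hμ₁ hμ₂ θ; linarith

/-- `x' = -sin y / c`, `y' = sin x / c`. [folklore] -/
theorem bandV_eq_sin_div (θ : ℝ) :
    bandVX μ θ = -Real.sin (bandY μ θ) / bandNormalCoeff μ θ ∧
    bandVY μ θ = Real.sin (bandX μ θ) / bandNormalCoeff μ θ := by
  have hc := bandNormalCoeff_pos hμ₁ hμ₂ θ
  rw [sin_bandX_eq hμ₁ hμ₂, sin_bandY_eq hμ₁ hμ₂]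
  constructor <;> field_simp

/-- The mixed product is `(ρ ρ'/c') sin(α - α')`:
`sin x(θ) x'(θ') + sin y(θ) y'(θ') = (ρ(θ) ρ(θ')/c(θ')) sin(α(θ) - α(θ'))`. [folklore] -/
theorem sin_mul_bandV_eq (θ θ' : ℝ) :
    Real.sin (bandX μ θ) * bandVX μ θ' + Real.sin (bandY μ θ) * bandVY μ θ' =
      Real.sqrt (Real.sin (bandX μ θ) ^ 2 + Real.sin (bandY μ θ) ^ 2) *
        Real.sqrt (Real.sin (bandX μ θ') ^ 2 + Real.sin (bandY μ θ') ^ 2) / bandNormalCoeff μ θ' *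
        Real.sin (bandNormalAngle μ θ - bandNormalAngle μ θ') := by
  obtain ⟨ρ, hρ, hx, hy⟩ := sin_bandXY_eq_polar hμ₁ hμ₂ θ
  obtain ⟨ρ', hρ', hx', hy'⟩ := sin_bandXY_eq_polar hμ₁ hμ₂ θ'
  have hρeq : Real.sqrt (Real.sin (bandX μ θ) ^ 2 + Real.sin (bandY μ θ) ^ 2) = ρ := by
    rw [hx, hy]
    have : (ρ * Real.cos (bandNormalAngle μ θ)) ^ 2 + (ρ * Real.sin (bandNormalAngle μ θ)) ^ 2 = ρ ^ 2 := by
      have := Real.cos_sq_add_sin_sq (bandNormalAngle μ θ); nlinarith [this]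
    rw [this, Real.sqrt_sq hρ.le]
  have hρeq' : Real.sqrt (Real.sin (bandX μ θ') ^ 2 + Real.sin (bandY μ θ') ^ 2) = ρ' := by
    rw [hx', hy']
    have : (ρ' * Real.cos (bandNormalAngle μ θ')) ^ 2 + (ρ' * Real.sin (bandNormalAngle μ θ')) ^ 2 = ρ' ^ 2 := by
      have := Real.cos_sq_add_sin_sq (bandNormalAngle μ θ'); nlinarith [this]
    rw [this, Real.sqrt_sq hρ'.le]
  obtain ⟨hvx, hvy⟩ := bandV_eq_sin_div hμ₁ hμ₂ θ'
  have hc := bandNormalCoeff_pos hμ₁ hμ₂ θ'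
  rw [hρeq, hρeq', hvx, hvy, hx', hy', hx, hy, Real.sin_sub]
  field_simp
  ring

end Level

/-! ### Lipschitz bounds of the curve data on the level range -/

section Bounds

variable {a b : ℝ} (B : BandBounds a b) {μ : ℝ} (hμ : μ ∈ Icc a b)
include hμ

/-- `|X(θ) - X(θ')| ≤ s_max |θ - θ'|`. [folklore] -/
theorem abs_bandX_sub_le (θ θ' : ℝ) : |bandX μ θ - bandX μ θ'| ≤ B.smax * |θ - θ'| := by
  obtain ⟨h1, h2⟩ := B.level hμ
  have h := (convex_univ (𝕜 := ℝ) (E := ℝ)).norm_image_sub_le_of_norm_hasDerivWithin_le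
    (f := bandX μ) (f' := bandVX μ) (fun t _ => (hasDerivAt_bandX h1 h2 t).hasDerivWithinAt)
    (fun t _ => by rw [Real.norm_eq_abs]; exact B.abs_VX_le μ hμ t) (mem_univ θ') (mem_univ θ)
  rwa [Real.norm_eq_abs, Real.norm_eq_abs] at h

/-- `|Y(θ) - Y(θ')| ≤ s_max |θ - θ'|`. [folklore] -/
theorem abs_bandY_sub_le (θ θ' : ℝ) : |bandY μ θ - bandY μ θ'| ≤ B.smax * |θ - θ'| := by
  obtain ⟨h1, h2⟩ := B.level hμ
  have h := (convex_univ (𝕜 := ℝ) (E := ℝ)).norm_image_sub_le_of_norm_hasDerivWithin_le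
    (f := bandY μ) (f' := bandVY μ) (fun t _ => (hasDerivAt_bandY h1 h2 t).hasDerivWithinAt)
    (fun t _ => by rw [Real.norm_eq_abs]; exact B.abs_VY_le μ hμ t) (mem_univ θ') (mem_univ θ)
  rwa [Real.norm_eq_abs, Real.norm_eq_abs] at h

/-- `|X'(θ) - X'(θ')| ≤ A₂ |θ - θ'|`. [folklore] -/
theorem abs_bandVX_sub_le (θ θ' : ℝ) : |bandVX μ θ - bandVX μ θ'| ≤ B.A2 * |θ - θ'| := by
  obtain ⟨h1, h2⟩ := B.level hμ
  have h := (convex_univ (𝕜 := ℝ) (E := ℝ)).norm_image_sub_le_of_norm_hasDerivWithin_le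
    (f := bandVX μ) (f' := bandAX μ) (fun t _ => (hasDerivAt_bandVX h1 h2 t).hasDerivWithinAt)
    (fun t _ => by rw [Real.norm_eq_abs]; exact B.abs_AX_le μ hμ t) (mem_univ θ') (mem_univ θ)
  rwa [Real.norm_eq_abs, Real.norm_eq_abs] at h

/-- `|Y'(θ) - Y'(θ')| ≤ A₂ |θ - θ'|`. [folklore] -/
theorem abs_bandVY_sub_le (θ θ' : ℝ) : |bandVY μ θ - bandVY μ θ'| ≤ B.A2 * |θ - θ'| := by
  obtain ⟨h1, h2⟩ := B.level hμ
  have h := (convex_univ (𝕜 := ℝ) (E := ℝ)).norm_image_sub_le_of_norm_hasDerivWithin_le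
    (f := bandVY μ) (f' := bandAY μ) (fun t _ => (hasDerivAt_bandVY h1 h2 t).hasDerivWithinAt)
    (fun t _ => by rw [Real.norm_eq_abs]; exact B.abs_AY_le μ hμ t) (mem_univ θ') (mem_univ θ)
  rwa [Real.norm_eq_abs, Real.norm_eq_abs] at h

/-- **Quantitative injectivity of the Gauss map modulo `π`**: if
`|sin x(θ)·x'(θ') + sin y(θ)·y'(θ')| ≤ ε` then `θ ≡ θ'` modulo `π` up to `C_g ε`. [folklore] -/
theorem exists_int_near_of_cross_small {θ θ' ε : ℝ}
    (h : |Real.sin (bandX μ θ) * bandVX μ θ' + Real.sin (bandY μ θ) * bandVY μ θ'| ≤ ε) :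
    ∃ j : ℤ, |θ - θ' - j * π| ≤ B.Cg * ε := by
  obtain ⟨h1, h2⟩ := B.level hμ
  have hε : 0 ≤ ε := (abs_nonneg _).trans h
  set ρ := Real.sqrt (Real.sin (bandX μ θ) ^ 2 + Real.sin (bandY μ θ) ^ 2) with hρ
  set ρ' := Real.sqrt (Real.sin (bandX μ θ') ^ 2 + Real.sin (bandY μ θ') ^ 2) with hρ'
  have hρge : B.rhomin ≤ ρ := B.rho_ge μ hμ θ
  have hρ'ge : B.rhomin ≤ ρ' := B.rho_ge μ hμ θ'
  have hrpos := B.rhomin_pos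
  have hc := bandNormalCoeff_pos h1 h2 θ'
  have hcle : bandNormalCoeff μ θ' ≤ B.cmax := B.c_le μ hμ θ'
  set x := bandNormalAngle μ θ - bandNormalAngle μ θ' with hx
  rw [sin_mul_bandV_eq h1 h2 θ θ'] at h
  -- `|sin x| ≤ ε c_max / ρ_min²`
  have hsin : |Real.sin x| ≤ ε * B.cmax / B.rhomin ^ 2 := by
    rw [abs_mul, abs_div, abs_mul, abs_of_nonneg (Real.sqrt_nonneg _), abs_of_nonneg (Real.sqrt_nonneg _),
      abs_of_pos hc] at h
    rw [le_div_iff₀ (by positivity)]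
    have hρρ : B.rhomin ^ 2 ≤ ρ * ρ' := by
      rw [sq]; exact mul_le_mul hρge hρ'ge hrpos.le ((hrpos.le).trans hρge)
    have h' : ρ * ρ' * |Real.sin x| ≤ ε * bandNormalCoeff μ θ' := by
      rw [div_mul_eq_mul_div, div_le_iff₀ hc] at h; linarith
    calc |Real.sin x| * B.rhomin ^ 2 ≤ |Real.sin x| * (ρ * ρ') := mul_le_mul_of_nonneg_left hρρ (abs_nonneg _)
      _ = ρ * ρ' * |Real.sin x| := by ring
      _ ≤ ε * bandNormalCoeff μ θ' := h'
      _ ≤ ε * B.cmax := mul_le_mul_of_nonneg_left hcle hε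
  -- nearest multiple of `π`
  set j : ℤ := ⌊x / π + 1 / 2⌋ with hj
  have hjx : |x - j * π| ≤ π / 2 := by
    have hfl := Int.floor_le (x / π + 1 / 2)
    have hlt := Int.lt_floor_add_one (x / π + 1 / 2)
    rw [← hj] at hfl hlt
    have hπ := Real.pi_pos
    rw [abs_le]; constructor
    · have : (j : ℝ) - 1 / 2 ≤ x / π := by linarith
      rw [le_div_iff₀ hπ] at this; linarith
    · have : x / π < j + 1 / 2 := by linarith
      rw [div_lt_iff₀ hπ] at this; linarith
  -- Jordan on `x - jπ`
  have hjordan : 2 / π * |x - j * π| ≤ |Real.sin (x - j * π)| := by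
    rcases le_or_gt 0 (x - j * π) with hs | hs
    · rw [abs_of_nonneg hs]
      have := Real.mul_le_sin hs (by rw [abs_of_nonneg hs] at hjx; exact hjx)
      exact this.trans (le_abs_self _)
    · rw [abs_of_neg hs]
      have hjx' : -(x - j * π) ≤ π / 2 := by rw [abs_of_neg hs] at hjx; exact hjx
      have := Real.mul_le_sin (by linarith) hjx'
      rw [Real.sin_neg] at this
      exact this.trans (neg_le_abs _)
  have hsineq : |Real.sin (x - j * π)| = |Real.sin x| := by
    rw [show x - j * π = x + (-j : ℤ) * π by push_cast; ring, Real.sin_add_int_mul_pi, abs_mul,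
      abs_zpow, abs_neg, abs_one, one_zpow, one_mul]
  rw [hsineq] at hjordan
  -- Gauss expansion
  have hgauss := B.gauss μ hμ θ (θ' + j * π)
  rw [bandNormalAngle_add_int_mul_pi h1 h2] at hgauss
  have heq : bandNormalAngle μ θ - (bandNormalAngle μ θ' + j * π) = x - j * π := by rw [hx]; ring
  rw [heq] at hgauss
  have hamin := B.amin_pos
  refine ⟨j, ?_⟩
  have hfinal : B.amin * |θ - θ' - j * π| ≤ π / 2 * (ε * B.cmax / B.rhomin ^ 2) := by
    have e1 : |θ - (θ' + j * π)| = |θ - θ' - j * π| := by ring_nf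
    rw [e1] at hgauss
    have e2 : |x - j * π| ≤ π / 2 * |Real.sin x| := by
      have hπ := Real.pi_pos
      have := hjordan
      rw [div_mul_eq_mul_div, div_le_iff₀ hπ] at this
      nlinarith
    calc B.amin * |θ - θ' - j * π| ≤ |x - j * π| := hgauss
      _ ≤ π / 2 * |Real.sin x| := e2
      _ ≤ π / 2 * (ε * B.cmax / B.rhomin ^ 2) := mul_le_mul_of_nonneg_left hsin (by positivity)
  rw [BandBounds.Cg]
  have hfinal' : |θ - θ' - j * π| ≤ π / 2 * (ε * B.cmax / B.rhomin ^ 2) / B.amin := by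
    rw [le_div_iff₀ hamin]; linarith
  calc |θ - θ' - j * π| ≤ π / 2 * (ε * B.cmax / B.rhomin ^ 2) / B.amin := hfinal'
    _ = π * B.cmax / (2 * B.amin * B.rhomin ^ 2) * ε := by field_simp

omit hμ in
/-- **The level is Lipschitz in `μ`**: `|u_ν(φ) - u_ν'(φ)| ≤ |ν - ν'| / Dt_min` on the range. [folklore] -/
theorem abs_bandFermiRadius_level_sub_le {ν ν' : ℝ} (hν : ν ∈ Icc a b) (hν' : ν' ∈ Icc a b) (φ : ℝ) :
    |bandFermiRadius ν φ - bandFermiRadius ν' φ| ≤ |ν - ν'| / B.Dtmin := by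
  have hD := B.Dtmin_pos
  have h := (convex_Icc a b).norm_image_sub_le_of_norm_hasDerivWithin_le
    (f := fun x => bandFermiRadius x φ) (f' := fun x => 1 / rayDispersionDt φ (bandFermiRadius x φ))
    (C := 1 / B.Dtmin)
    (fun x hx => (hasDerivAt_bandFermiRadius_level (B.level hx).1 (B.level hx).2 φ).hasDerivWithinAt)
    (fun x hx => by
      have hge := B.Dt_ge x hx φ
      have hpos : 0 < rayDispersionDt φ (bandFermiRadius x φ) := hD.trans_le hge
      rw [norm_div, norm_one, Real.norm_eq_abs, abs_of_pos hpos]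
      exact one_div_le_one_div_of_le hD hge) hν' hν
  rw [Real.norm_eq_abs, Real.norm_eq_abs] at h
  calc |bandFermiRadius ν φ - bandFermiRadius ν' φ| ≤ 1 / B.Dtmin * |ν - ν'| := h
    _ = |ν - ν'| / B.Dtmin := by ring

omit hμ in
/-- A point of the closed square on the level `ε₂ = ν`, `ν ∈ (-4, 0)`, is the polar point of angle
`arg (X + iY)`. [folklore] -/
theorem band_eq_of_level {ν X Y : ℝ} (hν₁ : -4 < ν) (hν₂ : ν < 0) (hX : |X| ≤ π) (hY : |Y| ≤ π)
    (he : eps2 X Y = ν) :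
    bandX ν (Complex.arg (⟨X, Y⟩ : ℂ)) = X ∧ bandY ν (Complex.arg (⟨X, Y⟩ : ℂ)) = Y := by
  set z : ℂ := ⟨X, Y⟩ with hz
  have hz0 : z ≠ 0 := by
    intro h0
    have h00 : X = 0 := by simpa [hz] using congrArg Complex.re h0
    have h01 : Y = 0 := by simpa [hz] using congrArg Complex.im h0
    have : eps2 X Y = -4 := by rw [h00, h01]; simp [eps2]; norm_num
    linarith
  set φ := Complex.arg z with hφ
  set r := ‖z‖ with hr
  have hrpos : 0 < r := norm_pos_iff.2 hz0
  have hcos : r * Real.cos φ = X := by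
    rw [hφ, Complex.cos_arg hz0, hr, mul_div_cancel₀ _ (norm_ne_zero_iff.2 hz0)]
  have hsin : r * Real.sin φ = Y := by
    rw [hφ, Complex.sin_arg, hr, mul_div_cancel₀ _ (norm_ne_zero_iff.2 hz0)]
  have hroot : IsBandFermiRadius ν φ r := by
    refine ⟨⟨hrpos.le, ?_⟩, ?_⟩
    · rw [← norm_smul_dir hrpos.le, Pi.norm_def]
      -- sup norm of `r • dir φ = (X, Y)`
      have hvec : r • dir φ = ![X, Y] := by
        ext i; fin_cases i
        · simpa using hcos
        · simpa using hsin
      rw [hvec]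
      have : (Finset.univ.sup fun i : Fin 2 => ‖(![X, Y] : Fin 2 → ℝ) i‖₊) ≤ ⟨π, Real.pi_pos.le⟩ := by
        apply Finset.sup_le
        intro i _
        fin_cases i
        · change ‖X‖₊ ≤ _
          rw [← NNReal.coe_le_coe, coe_nnnorm, Real.norm_eq_abs]; exact hX
        · change ‖Y‖₊ ≤ _
          rw [← NNReal.coe_le_coe, coe_nnnorm, Real.norm_eq_abs]; exact hY
      exact_mod_cast this
    · show sqDispersion (r • dir φ) = ν
      have hvec : r • dir φ = ![X, Y] := by
        ext i; fin_cases i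
        · simpa using hcos
        · simpa using hsin
      rw [hvec]; simpa [sqDispersion, eps2] using he
  have hru : r = bandFermiRadius ν φ := bandFermiRadius_unique hν₁ hν₂ hroot
  refine ⟨?_, ?_⟩
  · rw [bandX, ← hru]; exact hcos
  · rw [bandY, ← hru]; exact hsin

/-- **Localisation**: a point `(X, Y)` with `|ε₂(X, Y) - μ| ≤ η`, `μ ± η` in the range, is within
`η / Dt_min` (coordinatewise, modulo `2πℤ²`) of a point `p_μ(φ)` of the curve. [folklore] -/
theorem exists_near_curve {X Y η : ℝ} (hη : |eps2 X Y - μ| ≤ η) (hlo : a ≤ μ - η) (hhi : μ + η ≤ b) :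
    ∃ φ : ℝ, ∃ m₀ m₁ : ℤ, |X - m₀ * (2 * π) - bandX μ φ| ≤ η / B.Dtmin ∧
      |Y - m₁ * (2 * π) - bandY μ φ| ≤ η / B.Dtmin := by
  obtain ⟨m₀, hm₀⟩ := exists_int_abs_sub_le_pi X
  obtain ⟨m₁, hm₁⟩ := exists_int_abs_sub_le_pi Y
  set X' := X - m₀ * (2 * π) with hX'
  set Y' := Y - m₁ * (2 * π) with hY'
  set ν := eps2 X' Y' with hν
  have hνeq : ν = eps2 X Y := eps2_sub_int_mul X Y m₀ m₁
  have hνmem : ν ∈ Icc a b := by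
    rw [hνeq]; have := abs_le.1 hη; constructor <;> linarith
  obtain ⟨hν₁, hν₂⟩ := B.level hνmem
  obtain ⟨hbx, hby⟩ := band_eq_of_level hν₁ hν₂ hm₀ hm₁ rfl
  set φ := Complex.arg (⟨X', Y'⟩ : ℂ) with hφ
  refine ⟨φ, m₀, m₁, ?_, ?_⟩
  · have hu := abs_bandFermiRadius_level_sub_le B hνmem hμ φ
    have hνμ : |ν - μ| ≤ η := by rw [hνeq]; exact hη
    calc |X' - bandX μ φ| = |bandX ν φ - bandX μ φ| := by rw [hbx]
      _ = |bandFermiRadius ν φ - bandFermiRadius μ φ| * |Real.cos φ| := by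
          rw [bandX, bandX, ← sub_mul, abs_mul]
      _ ≤ |bandFermiRadius ν φ - bandFermiRadius μ φ| := mul_le_of_le_one_right (abs_nonneg _) (Real.abs_cos_le_one φ)
      _ ≤ |ν - μ| / B.Dtmin := hu
      _ ≤ η / B.Dtmin := div_le_div_of_nonneg_right hνμ B.Dtmin_pos.le
  · have hu := abs_bandFermiRadius_level_sub_le B hνmem hμ φ
    have hνμ : |ν - μ| ≤ η := by rw [hνeq]; exact hη
    calc |Y' - bandY μ φ| = |bandY ν φ - bandY μ φ| := by rw [hby]
      _ = |bandFermiRadius ν φ - bandFermiRadius μ φ| * |Real.sin φ| := by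
          rw [bandY, bandY, ← sub_mul, abs_mul]
      _ ≤ |bandFermiRadius ν φ - bandFermiRadius μ φ| := mul_le_of_le_one_right (abs_nonneg _) (Real.abs_sin_le_one φ)
      _ ≤ |ν - μ| / B.Dtmin := hu
      _ ≤ η / B.Dtmin := div_le_div_of_nonneg_right hνμ B.Dtmin_pos.le

end Bounds

/-! ### Trigonometric form of localisation and alignment modulo `π` -/

section Align

variable {a b : ℝ} (B : BandBounds a b) {μ : ℝ} (hμ : μ ∈ Icc a b)
include hμ

/-- Localisation in trigonometric form: `sin` and `cos` of the coordinates of a point with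
`|ε₂ - μ| ≤ η` are within `η / Dt_min` of those of a curve point. [folklore] -/
theorem exists_near_curve_trig {X Y η : ℝ} (hη : |eps2 X Y - μ| ≤ η) (hlo : a ≤ μ - η) (hhi : μ + η ≤ b) :
    ∃ φ : ℝ, |Real.sin X - Real.sin (bandX μ φ)| ≤ η / B.Dtmin ∧ |Real.sin Y - Real.sin (bandY μ φ)| ≤ η / B.Dtmin ∧
      |Real.cos X - Real.cos (bandX μ φ)| ≤ η / B.Dtmin ∧ |Real.cos Y - Real.cos (bandY μ φ)| ≤ η / B.Dtmin := by
  obtain ⟨φ, m₀, m₁, hx, hy⟩ := exists_near_curve B hμ hη hlo hhi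
  refine ⟨φ, ?_, ?_, ?_, ?_⟩
  · rw [← Real.sin_sub_int_mul_two_pi X m₀]
    exact (Real.abs_sin_sub_sin_le _ _).trans hx
  · rw [← Real.sin_sub_int_mul_two_pi Y m₁]
    exact (Real.abs_sin_sub_sin_le _ _).trans hy
  · rw [← Real.cos_sub_int_mul_two_pi X m₀]
    exact (Real.abs_cos_sub_cos_le _ _).trans hx
  · rw [← Real.cos_sub_int_mul_two_pi Y m₁]
    exact (Real.abs_cos_sub_cos_le _ _).trans hy

/-- **Alignment modulo `π`**: if `|φ - ψ - jπ| ≤ e` then, for a sign `σ = ±1`,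
`σ sin X(φ) ≈ sin X(ψ)`, `σ sin Y(φ) ≈ sin Y(ψ)`, `cos X(φ) ≈ cos X(ψ)`, `cos Y(φ) ≈ cos Y(ψ)` up to
`s_max e`. [folklore] -/
theorem exists_sign_align {φ ψ e : ℝ} {j : ℤ} (h : |φ - ψ - j * π| ≤ e) :
    ∃ σ : ℝ, (σ = 1 ∨ σ = -1) ∧
      |σ * Real.sin (bandX μ φ) - Real.sin (bandX μ ψ)| ≤ B.smax * e ∧
      |σ * Real.sin (bandY μ φ) - Real.sin (bandY μ ψ)| ≤ B.smax * e ∧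
      |Real.cos (bandX μ φ) - Real.cos (bandX μ ψ)| ≤ B.smax * e ∧
      |Real.cos (bandY μ φ) - Real.cos (bandY μ ψ)| ≤ B.smax * e := by
  obtain ⟨h1, h2⟩ := B.level hμ
  set d := φ - ψ - j * π with hd
  have hφ : φ = ψ + d + j * π := by rw [hd]; ring
  obtain ⟨σ, hσ, hX, hY, -, -⟩ := band_add_int_mul_pi h1 h2 (ψ + d) j
  rw [← hφ] at hX hY
  have hσ2 : σ * σ = 1 := by rcases hσ with rfl | rfl <;> norm_num
  have hXe : σ * bandX μ φ = bandX μ (ψ + d) := by rw [hX, ← mul_assoc, hσ2, one_mul]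
  have hYe : σ * bandY μ φ = bandY μ (ψ + d) := by rw [hY, ← mul_assoc, hσ2, one_mul]
  have hdx : |bandX μ (ψ + d) - bandX μ ψ| ≤ B.smax * e := by
    refine (abs_bandX_sub_le B hμ _ _).trans ?_
    rw [show ψ + d - ψ = d by ring]; exact mul_le_mul_of_nonneg_left h B.smax_pos.le
  have hdy : |bandY μ (ψ + d) - bandY μ ψ| ≤ B.smax * e := by
    refine (abs_bandY_sub_le B hμ _ _).trans ?_
    rw [show ψ + d - ψ = d by ring]; exact mul_le_mul_of_nonneg_left h B.smax_pos.le
  have hsinσ : ∀ x : ℝ, Real.sin (σ * x) = σ * Real.sin x := by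
    intro x; rcases hσ with rfl | rfl
    · simp
    · simp [Real.sin_neg]
  have hcosσ : ∀ x : ℝ, Real.cos (σ * x) = Real.cos x := by
    intro x; rcases hσ with rfl | rfl
    · simp
    · simp [Real.cos_neg]
  refine ⟨σ, hσ, ?_, ?_, ?_, ?_⟩
  · rw [← hsinσ, hXe]; exact (Real.abs_sin_sub_sin_le _ _).trans hdx
  · rw [← hsinσ, hYe]; exact (Real.abs_sin_sub_sin_le _ _).trans hdy
  · rw [← hcosσ, hXe]; exact (Real.abs_cos_sub_cos_le _ _).trans hdx
  · rw [← hcosσ, hYe]; exact (Real.abs_cos_sub_cos_le _ _).trans hdy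

omit hμ in
/-- Perturbation of a two-term product sum. [folklore] -/
theorem abs_two_term_sub_le (p q p' q' x y : ℝ) :
    |p * x + q * y - (p' * x + q' * y)| ≤ |p - p'| * |x| + |q - q'| * |y| := by
  calc |p * x + q * y - (p' * x + q' * y)| = |(p - p') * x + (q - q') * y| := by ring_nf
    _ ≤ |(p - p') * x| + |(q - q') * y| := abs_add_le _ _
    _ = |p - p'| * |x| + |q - q'| * |y| := by rw [abs_mul, abs_mul]

end Align

section Deriv

variable {μ : ℝ} (hμ₁ : -4 < μ) (hμ₂ : μ < 0)
include hμ₁ hμ₂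

/-- `∂₃ h` is the derivative of `h` in `θ₃`. [folklore] -/
theorem hasDerivAt_hfun_three (θ₁ θ₂ θ₃ : ℝ) :
    HasDerivAt (fun x => hfun μ θ₁ θ₂ x) (h3 μ θ₁ θ₂ θ₃) θ₃ := by
  have hX : HasDerivAt (fun x => SX μ θ₁ θ₂ x) (bandVX μ θ₃) θ₃ := by
    unfold SX; exact (hasDerivAt_bandX hμ₁ hμ₂ θ₃).const_add _
  have hY : HasDerivAt (fun x => SY μ θ₁ θ₂ x) (bandVY μ θ₃) θ₃ := by
    unfold SY; exact (hasDerivAt_bandY hμ₁ hμ₂ θ₃).const_add _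
  have h := ((hX.cos.fun_add hY.cos).const_mul (-2)).sub_const μ
  unfold hfun eps2
  exact h.congr_deriv (by unfold h3; ring)

/-- `∂₃∂₃ h` is the derivative of `∂₃ h`. [folklore] -/
theorem hasDerivAt_h3 (θ₁ θ₂ θ₃ : ℝ) :
    HasDerivAt (fun x => h3 μ θ₁ θ₂ x) (h33 μ θ₁ θ₂ θ₃) θ₃ := by
  have hX : HasDerivAt (fun x => SX μ θ₁ θ₂ x) (bandVX μ θ₃) θ₃ := by
    unfold SX; exact (hasDerivAt_bandX hμ₁ hμ₂ θ₃).const_add _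
  have hY : HasDerivAt (fun x => SY μ θ₁ θ₂ x) (bandVY μ θ₃) θ₃ := by
    unfold SY; exact (hasDerivAt_bandY hμ₁ hμ₂ θ₃).const_add _
  have h := ((hX.sin.fun_mul (hasDerivAt_bandVX hμ₁ hμ₂ θ₃)).const_mul 2).fun_add
    ((hY.sin.fun_mul (hasDerivAt_bandVY hμ₁ hμ₂ θ₃)).const_mul 2)
  unfold h3
  refine (h.congr_deriv ?_).congr_of_eventuallyEq ?_
  · unfold h33; ring
  · exact Filter.Eventually.of_forall fun x => by ring

/-- The derivative of `θ₂ ↦ h(θ₂, θ₂ + c)`. [folklore] -/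
theorem hasDerivAt_hfun_diag (θ₁ c θ₂ : ℝ) :
    HasDerivAt (fun x => hfun μ θ₁ x (x + c))
      (2 * Real.sin (SX μ θ₁ θ₂ (θ₂ + c)) * (bandVX μ θ₂ + bandVX μ (θ₂ + c)) +
        2 * Real.sin (SY μ θ₁ θ₂ (θ₂ + c)) * (bandVY μ θ₂ + bandVY μ (θ₂ + c))) θ₂ := by
  have hX : HasDerivAt (fun x => SX μ θ₁ x (x + c)) (bandVX μ θ₂ + bandVX μ (θ₂ + c)) θ₂ := by
    unfold SX
    exact ((hasDerivAt_bandX hμ₁ hμ₂ θ₂).const_add _).fun_add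
      ((hasDerivAt_bandX hμ₁ hμ₂ (θ₂ + c)).comp_add_const θ₂ c)
  have hY : HasDerivAt (fun x => SY μ θ₁ x (x + c)) (bandVY μ θ₂ + bandVY μ (θ₂ + c)) θ₂ := by
    unfold SY
    exact ((hasDerivAt_bandY hμ₁ hμ₂ θ₂).const_add _).fun_add
      ((hasDerivAt_bandY hμ₁ hμ₂ (θ₂ + c)).comp_add_const θ₂ c)
  have h := ((hX.cos.fun_add hY.cos).const_mul (-2)).sub_const μ
  unfold hfun eps2
  exact h.congr_deriv (by ring)

/-- The derivative of `t ↦ h(σ - t/2, σ + t/2)`. [folklore] -/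
theorem hasDerivAt_hfun_anti (θ₁ σ t : ℝ) :
    HasDerivAt (fun s => hfun μ θ₁ (σ - s / 2) (σ + s / 2))
      (Real.sin (SX μ θ₁ (σ - t / 2) (σ + t / 2)) * (bandVX μ (σ + t / 2) - bandVX μ (σ - t / 2)) +
        Real.sin (SY μ θ₁ (σ - t / 2) (σ + t / 2)) * (bandVY μ (σ + t / 2) - bandVY μ (σ - t / 2))) t := by
  have hm : HasDerivAt (fun s : ℝ => σ - s / 2) (-(1 / 2)) t := by
    have := ((hasDerivAt_id' t).div_const 2).const_sub σ
    exact this.congr_deriv (by ring)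
  have hp : HasDerivAt (fun s : ℝ => σ + s / 2) (1 / 2) t := by
    have := ((hasDerivAt_id' t).div_const 2).const_add σ
    exact this.congr_deriv (by ring)
  have hXm₀ := (hasDerivAt_bandX hμ₁ hμ₂ (σ - t / 2)).comp t hm
  have hXm : HasDerivAt (fun s => bandX μ (σ - s / 2)) (bandVX μ (σ - t / 2) * (-(1 / 2))) t := hXm₀
  have hXp₀ := (hasDerivAt_bandX hμ₁ hμ₂ (σ + t / 2)).comp t hp
  have hXp : HasDerivAt (fun s => bandX μ (σ + s / 2)) (bandVX μ (σ + t / 2) * (1 / 2)) t := hXp₀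
  have hYm₀ := (hasDerivAt_bandY hμ₁ hμ₂ (σ - t / 2)).comp t hm
  have hYm : HasDerivAt (fun s => bandY μ (σ - s / 2)) (bandVY μ (σ - t / 2) * (-(1 / 2))) t := hYm₀
  have hYp₀ := (hasDerivAt_bandY hμ₁ hμ₂ (σ + t / 2)).comp t hp
  have hYp : HasDerivAt (fun s => bandY μ (σ + s / 2)) (bandVY μ (σ + t / 2) * (1 / 2)) t := hYp₀
  have hX : HasDerivAt (fun s => SX μ θ₁ (σ - s / 2) (σ + s / 2))
      (bandVX μ (σ - t / 2) * (-(1 / 2)) + bandVX μ (σ + t / 2) * (1 / 2)) t := by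
    unfold SX; exact (hXm.const_add _).fun_add hXp
  have hY : HasDerivAt (fun s => SY μ θ₁ (σ - s / 2) (σ + s / 2))
      (bandVY μ (σ - t / 2) * (-(1 / 2)) + bandVY μ (σ + t / 2) * (1 / 2)) t := by
    unfold SY; exact (hYm.const_add _).fun_add hYp
  have h := ((hX.cos.fun_add hY.cos).const_mul (-2)).sub_const μ
  unfold hfun eps2
  exact h.congr_deriv (by ring)

/-- The derivative of the diagonal function `H(σ) = h(σ, σ)`. [folklore] -/
theorem hasDerivAt_hfun_diag_zero (θ₁ σ : ℝ) :
    HasDerivAt (fun x => hfun μ θ₁ x x)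
      (4 * (Real.sin (SX μ θ₁ σ σ) * bandVX μ σ + Real.sin (SY μ θ₁ σ σ) * bandVY μ σ)) σ := by
  have h := hasDerivAt_hfun_diag hμ₁ hμ₂ θ₁ 0 σ
  simp only [add_zero] at h
  exact h.congr_deriv (by ring)

/-- The second derivative of the diagonal function. [folklore] -/
theorem hasDerivAt_hfun_diag_zero_deriv (θ₁ σ : ℝ) :
    HasDerivAt (fun x => 4 * (Real.sin (SX μ θ₁ x x) * bandVX μ x + Real.sin (SY μ θ₁ x x) * bandVY μ x))
      (8 * (Real.cos (SX μ θ₁ σ σ) * bandVX μ σ ^ 2 + Real.cos (SY μ θ₁ σ σ) * bandVY μ σ ^ 2) +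
        4 * (Real.sin (SX μ θ₁ σ σ) * bandAX μ σ + Real.sin (SY μ θ₁ σ σ) * bandAY μ σ)) σ := by
  have hX : HasDerivAt (fun x => SX μ θ₁ x x) (2 * bandVX μ σ) σ := by
    unfold SX
    have := ((hasDerivAt_bandX hμ₁ hμ₂ σ).const_add (bandX μ θ₁)).fun_add (hasDerivAt_bandX hμ₁ hμ₂ σ)
    exact this.congr_deriv (by ring)
  have hY : HasDerivAt (fun x => SY μ θ₁ x x) (2 * bandVY μ σ) σ := by
    unfold SY
    have := ((hasDerivAt_bandY hμ₁ hμ₂ σ).const_add (bandY μ θ₁)).fun_add (hasDerivAt_bandY hμ₁ hμ₂ σ)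
    exact this.congr_deriv (by ring)
  have h := ((hX.sin.fun_mul (hasDerivAt_bandVX hμ₁ hμ₂ σ)).fun_add
    (hY.sin.fun_mul (hasDerivAt_bandVY hμ₁ hμ₂ σ))).const_mul 4
  exact h.congr_deriv (by ring)

/-- The `t`-derivative of `G`. [folklore] -/
theorem hasDerivAt_Gfun (θ₁ σ t : ℝ) :
    HasDerivAt (fun s => Gfun μ θ₁ σ s)
      (2 * (Real.cos (SX μ θ₁ (σ - t / 2) (σ + t / 2)) *
            (bandVX μ (σ - t / 2) * (-(1 / 2)) + bandVX μ (σ + t / 2) * (1 / 2)) *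
            (bandVX μ (σ - t / 2) + bandVX μ (σ + t / 2)) +
          Real.sin (SX μ θ₁ (σ - t / 2) (σ + t / 2)) *
            (bandAX μ (σ - t / 2) * (-(1 / 2)) + bandAX μ (σ + t / 2) * (1 / 2))) +
        2 * (Real.cos (SY μ θ₁ (σ - t / 2) (σ + t / 2)) *
            (bandVY μ (σ - t / 2) * (-(1 / 2)) + bandVY μ (σ + t / 2) * (1 / 2)) *
            (bandVY μ (σ - t / 2) + bandVY μ (σ + t / 2)) +
          Real.sin (SY μ θ₁ (σ - t / 2) (σ + t / 2)) *
            (bandAY μ (σ - t / 2) * (-(1 / 2)) + bandAY μ (σ + t / 2) * (1 / 2)))) t := by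
  have hm : HasDerivAt (fun s : ℝ => σ - s / 2) (-(1 / 2)) t := by
    have := ((hasDerivAt_id' t).div_const 2).const_sub σ
    exact this.congr_deriv (by ring)
  have hp : HasDerivAt (fun s : ℝ => σ + s / 2) (1 / 2) t := by
    have := ((hasDerivAt_id' t).div_const 2).const_add σ
    exact this.congr_deriv (by ring)
  have hXm₀ := (hasDerivAt_bandX hμ₁ hμ₂ (σ - t / 2)).comp t hm
  have hXm : HasDerivAt (fun s => bandX μ (σ - s / 2)) (bandVX μ (σ - t / 2) * (-(1 / 2))) t := hXm₀
  have hXp₀ := (hasDerivAt_bandX hμ₁ hμ₂ (σ + t / 2)).comp t hp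
  have hXp : HasDerivAt (fun s => bandX μ (σ + s / 2)) (bandVX μ (σ + t / 2) * (1 / 2)) t := hXp₀
  have hYm₀ := (hasDerivAt_bandY hμ₁ hμ₂ (σ - t / 2)).comp t hm
  have hYm : HasDerivAt (fun s => bandY μ (σ - s / 2)) (bandVY μ (σ - t / 2) * (-(1 / 2))) t := hYm₀
  have hYp₀ := (hasDerivAt_bandY hμ₁ hμ₂ (σ + t / 2)).comp t hp
  have hYp : HasDerivAt (fun s => bandY μ (σ + s / 2)) (bandVY μ (σ + t / 2) * (1 / 2)) t := hYp₀
  have hVXm₀ := (hasDerivAt_bandVX hμ₁ hμ₂ (σ - t / 2)).comp t hm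
  have hVXm : HasDerivAt (fun s => bandVX μ (σ - s / 2)) (bandAX μ (σ - t / 2) * (-(1 / 2))) t := hVXm₀
  have hVXp₀ := (hasDerivAt_bandVX hμ₁ hμ₂ (σ + t / 2)).comp t hp
  have hVXp : HasDerivAt (fun s => bandVX μ (σ + s / 2)) (bandAX μ (σ + t / 2) * (1 / 2)) t := hVXp₀
  have hVYm₀ := (hasDerivAt_bandVY hμ₁ hμ₂ (σ - t / 2)).comp t hm
  have hVYm : HasDerivAt (fun s => bandVY μ (σ - s / 2)) (bandAY μ (σ - t / 2) * (-(1 / 2))) t := hVYm₀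
  have hVYp₀ := (hasDerivAt_bandVY hμ₁ hμ₂ (σ + t / 2)).comp t hp
  have hVYp : HasDerivAt (fun s => bandVY μ (σ + s / 2)) (bandAY μ (σ + t / 2) * (1 / 2)) t := hVYp₀
  have hX : HasDerivAt (fun s => SX μ θ₁ (σ - s / 2) (σ + s / 2))
      (bandVX μ (σ - t / 2) * (-(1 / 2)) + bandVX μ (σ + t / 2) * (1 / 2)) t := by
    unfold SX; exact (hXm.const_add _).fun_add hXp
  have hY : HasDerivAt (fun s => SY μ θ₁ (σ - s / 2) (σ + s / 2))
      (bandVY μ (σ - t / 2) * (-(1 / 2)) + bandVY μ (σ + t / 2) * (1 / 2)) t := by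
    unfold SY; exact (hYm.const_add _).fun_add hYp
  unfold Gfun
  exact ((hX.sin.fun_mul (hVXm.fun_add hVXp)).const_mul 2).fun_add
    ((hY.sin.fun_mul (hVYm.fun_add hVYp)).const_mul 2)

end Deriv

/-! ### A two-sided mean value lemma -/

/-- Mean value theorem for an increment of either sign: `f(x + t) - f(x) = t f'(ξ)` with `ξ`
between `x` and `x + t`. [folklore] -/
theorem exists_slope {f f' : ℝ → ℝ} (hf : ∀ x, HasDerivAt f (f' x) x) (x t : ℝ) :
    ∃ ξ, (min 0 t ≤ ξ - x ∧ ξ - x ≤ max 0 t) ∧ f (x + t) - f x = t * f' ξ := by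
  have hcont : ∀ u v, ContinuousOn f (Icc u v) := fun u v z _ => (hf z).continuousAt.continuousWithinAt
  rcases lt_trichotomy t 0 with ht | rfl | ht
  · obtain ⟨c, hc, hslope⟩ := exists_hasDerivAt_eq_slope f f' (by linarith : x + t < x) (hcont _ _)
      (fun z _ => hf z)
    refine ⟨c, ⟨?_, ?_⟩, ?_⟩
    · rw [min_eq_right ht.le]; linarith [hc.1]
    · rw [max_eq_left ht.le]; linarith [hc.2]
    · have ht' : t ≠ 0 := ht.ne
      rw [hslope, show x - (x + t) = -t by ring]; field_simp; ring
  · exact ⟨x, ⟨by simp, by simp⟩, by simp⟩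
  · obtain ⟨c, hc, hslope⟩ := exists_hasDerivAt_eq_slope f f' (by linarith : x < x + t) (hcont _ _)
      (fun z _ => hf z)
    refine ⟨c, ⟨?_, ?_⟩, ?_⟩
    · rw [min_eq_left ht.le]; linarith [hc.1]
    · rw [max_eq_right ht.le]; linarith [hc.2]
    · have ht' : t ≠ 0 := ht.ne'
      rw [hslope, show x + t - x = t by ring]; field_simp

/-! ### Bounds on the derivatives -/

/-- A generic bound `|p x + q y| ≤ P X + Q Y` from `|p| ≤ P`, `|x| ≤ X`, `|q| ≤ Q`, `|y| ≤ Y`. [folklore] -/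
theorem abs_two_term_le {p q x y P Q X' Y' : ℝ} (hp : |p| ≤ P) (hx : |x| ≤ X') (hq : |q| ≤ Q) (hy : |y| ≤ Y') :
    |p * x + q * y| ≤ P * X' + Q * Y' := by
  have hP : 0 ≤ P := (abs_nonneg _).trans hp
  have hQ : 0 ≤ Q := (abs_nonneg _).trans hq
  calc |p * x + q * y| ≤ |p * x| + |q * y| := abs_add_le _ _
    _ = |p| * |x| + |q| * |y| := by rw [abs_mul, abs_mul]
    _ ≤ P * X' + Q * Y' := add_le_add (mul_le_mul hp hx (abs_nonneg _) hP) (mul_le_mul hq hy (abs_nonneg _) hQ)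

section DBounds

variable {a b : ℝ} (B : BandBounds a b) {μ : ℝ} (hμ : μ ∈ Icc a b)
include hμ

/-- `|∂₃∂₃ h| ≤ 4 s_max² + 4 A₂`. [folklore] -/
theorem abs_h33_le (θ₁ θ₂ θ₃ : ℝ) : |h33 μ θ₁ θ₂ θ₃| ≤ 4 * B.smax ^ 2 + 4 * B.A2 := by
  unfold h33
  have hs := B.smax_pos
  have hvx := B.abs_VX_le μ hμ θ₃; have hvy := B.abs_VY_le μ hμ θ₃
  have hax := B.abs_AX_le μ hμ θ₃; have hay := B.abs_AY_le μ hμ θ₃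
  have p1 : |Real.cos (SX μ θ₁ θ₂ θ₃) * bandVX μ θ₃| ≤ B.smax := by
    rw [abs_mul]
    calc _ ≤ 1 * B.smax := mul_le_mul (Real.abs_cos_le_one _) hvx (abs_nonneg _) zero_le_one
      _ = B.smax := one_mul _
  have p2 : |Real.cos (SY μ θ₁ θ₂ θ₃) * bandVY μ θ₃| ≤ B.smax := by
    rw [abs_mul]
    calc _ ≤ 1 * B.smax := mul_le_mul (Real.abs_cos_le_one _) hvy (abs_nonneg _) zero_le_one
      _ = B.smax := one_mul _
  have e1 : |Real.cos (SX μ θ₁ θ₂ θ₃) * bandVX μ θ₃ * bandVX μ θ₃ + Real.sin (SX μ θ₁ θ₂ θ₃) * bandAX μ θ₃| ≤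
      B.smax * B.smax + 1 * B.A2 := abs_two_term_le p1 hvx (Real.abs_sin_le_one _) hax
  have e2 : |Real.cos (SY μ θ₁ θ₂ θ₃) * bandVY μ θ₃ * bandVY μ θ₃ + Real.sin (SY μ θ₁ θ₂ θ₃) * bandAY μ θ₃| ≤
      B.smax * B.smax + 1 * B.A2 := abs_two_term_le p2 hvy (Real.abs_sin_le_one _) hay
  calc _ ≤ |2 * (Real.cos (SX μ θ₁ θ₂ θ₃) * bandVX μ θ₃ * bandVX μ θ₃ + Real.sin (SX μ θ₁ θ₂ θ₃) * bandAX μ θ₃)| +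
        |2 * (Real.cos (SY μ θ₁ θ₂ θ₃) * bandVY μ θ₃ * bandVY μ θ₃ + Real.sin (SY μ θ₁ θ₂ θ₃) * bandAY μ θ₃)| :=
        abs_add_le _ _
    _ ≤ 4 * B.smax ^ 2 + 4 * B.A2 := by rw [abs_mul, abs_mul, abs_two]; nlinarith

/-- `∂₃ h` is Lipschitz in `θ₃` with constant `4 s_max² + 4 A₂`. [folklore] -/
theorem abs_h3_sub_le (θ₁ θ₂ z z' : ℝ) :
    |h3 μ θ₁ θ₂ z - h3 μ θ₁ θ₂ z'| ≤ (4 * B.smax ^ 2 + 4 * B.A2) * |z - z'| := by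
  obtain ⟨h1, h2⟩ := B.level hμ
  have h := (convex_univ (𝕜 := ℝ) (E := ℝ)).norm_image_sub_le_of_norm_hasDerivWithin_le
    (f := fun x => h3 μ θ₁ θ₂ x) (f' := fun x => h33 μ θ₁ θ₂ x)
    (fun t _ => (hasDerivAt_h3 h1 h2 θ₁ θ₂ t).hasDerivWithinAt)
    (fun t _ => by rw [Real.norm_eq_abs]; exact abs_h33_le B hμ θ₁ θ₂ t) (mem_univ z') (mem_univ z)
  rw [Real.norm_eq_abs, Real.norm_eq_abs] at h
  exact h

/-- `|∂_t ĥ| ≤ 2 A₂ |t|` along the anti-diagonal. [folklore] -/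
theorem abs_anti_deriv_le (θ₁ σ t : ℝ) :
    |Real.sin (SX μ θ₁ (σ - t / 2) (σ + t / 2)) * (bandVX μ (σ + t / 2) - bandVX μ (σ - t / 2)) +
        Real.sin (SY μ θ₁ (σ - t / 2) (σ + t / 2)) * (bandVY μ (σ + t / 2) - bandVY μ (σ - t / 2))| ≤
      2 * B.A2 * |t| := by
  have hx := abs_bandVX_sub_le B hμ (σ + t / 2) (σ - t / 2)
  have hy := abs_bandVY_sub_le B hμ (σ + t / 2) (σ - t / 2)
  rw [show σ + t / 2 - (σ - t / 2) = t by ring] at hx hy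
  have := abs_two_term_le (Real.abs_sin_le_one _) hx (Real.abs_sin_le_one _) hy
    (p := Real.sin (SX μ θ₁ (σ - t / 2) (σ + t / 2))) (q := Real.sin (SY μ θ₁ (σ - t / 2) (σ + t / 2)))
  linarith

/-- `G` is Lipschitz in `t` with constant `8 s_max² + 4 A₂`. [folklore] -/
theorem abs_Gfun_sub_le (θ₁ σ t t' : ℝ) : |Gfun μ θ₁ σ t - Gfun μ θ₁ σ t'| ≤ (8 * B.smax ^ 2 + 4 * B.A2) * |t - t'| := by
  obtain ⟨h1, h2⟩ := B.level hμ
  have hs := B.smax_pos; have hA := B.A2_pos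
  have hbound : ∀ u : ℝ,
      |2 * (Real.cos (SX μ θ₁ (σ - u / 2) (σ + u / 2)) *
            (bandVX μ (σ - u / 2) * (-(1 / 2)) + bandVX μ (σ + u / 2) * (1 / 2)) *
            (bandVX μ (σ - u / 2) + bandVX μ (σ + u / 2)) +
          Real.sin (SX μ θ₁ (σ - u / 2) (σ + u / 2)) *
            (bandAX μ (σ - u / 2) * (-(1 / 2)) + bandAX μ (σ + u / 2) * (1 / 2))) +
        2 * (Real.cos (SY μ θ₁ (σ - u / 2) (σ + u / 2)) *
            (bandVY μ (σ - u / 2) * (-(1 / 2)) + bandVY μ (σ + u / 2) * (1 / 2)) *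
            (bandVY μ (σ - u / 2) + bandVY μ (σ + u / 2)) +
          Real.sin (SY μ θ₁ (σ - u / 2) (σ + u / 2)) *
            (bandAY μ (σ - u / 2) * (-(1 / 2)) + bandAY μ (σ + u / 2) * (1 / 2)))| ≤ 8 * B.smax ^ 2 + 4 * B.A2 := by
    intro u
    have v1 := B.abs_VX_le μ hμ (σ - u / 2); have v2 := B.abs_VX_le μ hμ (σ + u / 2)
    have v3 := B.abs_VY_le μ hμ (σ - u / 2); have v4 := B.abs_VY_le μ hμ (σ + u / 2)
    have a1 := B.abs_AX_le μ hμ (σ - u / 2); have a2 := B.abs_AX_le μ hμ (σ + u / 2)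
    have a3 := B.abs_AY_le μ hμ (σ - u / 2); have a4 := B.abs_AY_le μ hμ (σ + u / 2)
    have d1 : |bandVX μ (σ - u / 2) * (-(1 / 2)) + bandVX μ (σ + u / 2) * (1 / 2)| ≤ B.smax := by
      have := abs_two_term_le v1 (by norm_num : |(-(1/2) : ℝ)| ≤ 1 / 2) v2 (by norm_num : |((1/2) : ℝ)| ≤ 1 / 2)
      linarith
    have d2 : |bandVY μ (σ - u / 2) * (-(1 / 2)) + bandVY μ (σ + u / 2) * (1 / 2)| ≤ B.smax := by
      have := abs_two_term_le v3 (by norm_num : |(-(1/2) : ℝ)| ≤ 1 / 2) v4 (by norm_num : |((1/2) : ℝ)| ≤ 1 / 2)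
      linarith
    have d3 : |bandAX μ (σ - u / 2) * (-(1 / 2)) + bandAX μ (σ + u / 2) * (1 / 2)| ≤ B.A2 := by
      have := abs_two_term_le a1 (by norm_num : |(-(1/2) : ℝ)| ≤ 1 / 2) a2 (by norm_num : |((1/2) : ℝ)| ≤ 1 / 2)
      linarith
    have d4 : |bandAY μ (σ - u / 2) * (-(1 / 2)) + bandAY μ (σ + u / 2) * (1 / 2)| ≤ B.A2 := by
      have := abs_two_term_le a3 (by norm_num : |(-(1/2) : ℝ)| ≤ 1 / 2) a4 (by norm_num : |((1/2) : ℝ)| ≤ 1 / 2)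
      linarith
    have s1 : |bandVX μ (σ - u / 2) + bandVX μ (σ + u / 2)| ≤ 2 * B.smax := (abs_add_le _ _).trans (by linarith)
    have s2 : |bandVY μ (σ - u / 2) + bandVY μ (σ + u / 2)| ≤ 2 * B.smax := (abs_add_le _ _).trans (by linarith)
    have pd1 : |Real.cos (SX μ θ₁ (σ - u / 2) (σ + u / 2)) *
        (bandVX μ (σ - u / 2) * (-(1 / 2)) + bandVX μ (σ + u / 2) * (1 / 2))| ≤ B.smax := by
      rw [abs_mul]
      calc _ ≤ 1 * B.smax := mul_le_mul (Real.abs_cos_le_one _) d1 (abs_nonneg _) zero_le_one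
        _ = B.smax := one_mul _
    have pd2 : |Real.cos (SY μ θ₁ (σ - u / 2) (σ + u / 2)) *
        (bandVY μ (σ - u / 2) * (-(1 / 2)) + bandVY μ (σ + u / 2) * (1 / 2))| ≤ B.smax := by
      rw [abs_mul]
      calc _ ≤ 1 * B.smax := mul_le_mul (Real.abs_cos_le_one _) d2 (abs_nonneg _) zero_le_one
        _ = B.smax := one_mul _
    have t1 : |Real.cos (SX μ θ₁ (σ - u / 2) (σ + u / 2)) *
            (bandVX μ (σ - u / 2) * (-(1 / 2)) + bandVX μ (σ + u / 2) * (1 / 2)) *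
            (bandVX μ (σ - u / 2) + bandVX μ (σ + u / 2)) +
          Real.sin (SX μ θ₁ (σ - u / 2) (σ + u / 2)) *
            (bandAX μ (σ - u / 2) * (-(1 / 2)) + bandAX μ (σ + u / 2) * (1 / 2))| ≤ B.smax * (2 * B.smax) + 1 * B.A2 :=
      abs_two_term_le pd1 s1 (Real.abs_sin_le_one _) d3
    have t2 : |Real.cos (SY μ θ₁ (σ - u / 2) (σ + u / 2)) *
            (bandVY μ (σ - u / 2) * (-(1 / 2)) + bandVY μ (σ + u / 2) * (1 / 2)) *
            (bandVY μ (σ - u / 2) + bandVY μ (σ + u / 2)) +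
          Real.sin (SY μ θ₁ (σ - u / 2) (σ + u / 2)) *
            (bandAY μ (σ - u / 2) * (-(1 / 2)) + bandAY μ (σ + u / 2) * (1 / 2))| ≤ B.smax * (2 * B.smax) + 1 * B.A2 :=
      abs_two_term_le pd2 s2 (Real.abs_sin_le_one _) d4
    calc _ ≤ |2 * (Real.cos (SX μ θ₁ (σ - u / 2) (σ + u / 2)) *
            (bandVX μ (σ - u / 2) * (-(1 / 2)) + bandVX μ (σ + u / 2) * (1 / 2)) *
            (bandVX μ (σ - u / 2) + bandVX μ (σ + u / 2)) +
          Real.sin (SX μ θ₁ (σ - u / 2) (σ + u / 2)) *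
            (bandAX μ (σ - u / 2) * (-(1 / 2)) + bandAX μ (σ + u / 2) * (1 / 2)))| +
        |2 * (Real.cos (SY μ θ₁ (σ - u / 2) (σ + u / 2)) *
            (bandVY μ (σ - u / 2) * (-(1 / 2)) + bandVY μ (σ + u / 2) * (1 / 2)) *
            (bandVY μ (σ - u / 2) + bandVY μ (σ + u / 2)) +
          Real.sin (SY μ θ₁ (σ - u / 2) (σ + u / 2)) *
            (bandAY μ (σ - u / 2) * (-(1 / 2)) + bandAY μ (σ + u / 2) * (1 / 2)))| := abs_add_le _ _
      _ ≤ 8 * B.smax ^ 2 + 4 * B.A2 := by rw [abs_mul, abs_mul, abs_two]; nlinarith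
  have h := (convex_univ (𝕜 := ℝ) (E := ℝ)).norm_image_sub_le_of_norm_hasDerivWithin_le
    (f := fun x => Gfun μ θ₁ σ x)
    (fun u _ => (hasDerivAt_Gfun h1 h2 θ₁ σ u).hasDerivWithinAt)
    (fun u _ => by rw [Real.norm_eq_abs]; exact hbound u) (mem_univ t') (mem_univ t)
  rw [Real.norm_eq_abs, Real.norm_eq_abs] at h
  exact h

/-- `|H'| ≤ 8 s_max` for the diagonal function. [folklore] -/
theorem abs_diag_deriv_le (θ₁ σ : ℝ) :
    |4 * (Real.sin (SX μ θ₁ σ σ) * bandVX μ σ + Real.sin (SY μ θ₁ σ σ) * bandVY μ σ)| ≤ 8 * B.smax := by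
  have := abs_two_term_le (Real.abs_sin_le_one (SX μ θ₁ σ σ)) (B.abs_VX_le μ hμ σ)
    (Real.abs_sin_le_one (SY μ θ₁ σ σ)) (B.abs_VY_le μ hμ σ)
  rw [abs_mul, show |(4:ℝ)| = 4 by norm_num]; linarith

/-- `|H''| ≤ 16 s_max² + 8 A₂` for the diagonal function. [folklore] -/
theorem abs_diag_deriv2_le (θ₁ σ : ℝ) :
    |8 * (Real.cos (SX μ θ₁ σ σ) * bandVX μ σ ^ 2 + Real.cos (SY μ θ₁ σ σ) * bandVY μ σ ^ 2) +
        4 * (Real.sin (SX μ θ₁ σ σ) * bandAX μ σ + Real.sin (SY μ θ₁ σ σ) * bandAY μ σ)| ≤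
      16 * B.smax ^ 2 + 8 * B.A2 := by
  have hs := B.smax_pos
  have hvx := B.abs_VX_le μ hμ σ; have hvy := B.abs_VY_le μ hμ σ
  have hsq1 : |bandVX μ σ ^ 2| ≤ B.smax ^ 2 := by
    rw [abs_pow, sq, sq]; exact mul_le_mul hvx hvx (abs_nonneg _) hs.le
  have hsq2 : |bandVY μ σ ^ 2| ≤ B.smax ^ 2 := by
    rw [abs_pow, sq, sq]; exact mul_le_mul hvy hvy (abs_nonneg _) hs.le
  have e1 := abs_two_term_le (Real.abs_cos_le_one (SX μ θ₁ σ σ)) hsq1 (Real.abs_cos_le_one (SY μ θ₁ σ σ)) hsq2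
  have e2 := abs_two_term_le (Real.abs_sin_le_one (SX μ θ₁ σ σ)) (B.abs_AX_le μ hμ σ)
    (Real.abs_sin_le_one (SY μ θ₁ σ σ)) (B.abs_AY_le μ hμ σ)
  calc _ ≤ |8 * (Real.cos (SX μ θ₁ σ σ) * bandVX μ σ ^ 2 + Real.cos (SY μ θ₁ σ σ) * bandVY μ σ ^ 2)| +
        |4 * (Real.sin (SX μ θ₁ σ σ) * bandAX μ σ + Real.sin (SY μ θ₁ σ σ) * bandAY μ σ)| := abs_add_le _ _
    _ ≤ 16 * B.smax ^ 2 + 8 * B.A2 := by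
        rw [abs_mul, abs_mul, show |(8:ℝ)| = 8 by norm_num, show |(4:ℝ)| = 4 by norm_num]; linarith

end DBounds

/-! ### The non-degeneracy lemmas -/

/-- `h(θ₂, θ₂ + π) = 0` (the Cooper line). [folklore] -/
theorem hfun_add_pi {μ : ℝ} (hμ₁ : -4 < μ) (hμ₂ : μ < 0) (θ₁ θ₂ : ℝ) : hfun μ θ₁ θ₂ (θ₂ + π) = 0 := by
  obtain ⟨hx, hy, -, -⟩ := band_add_pi hμ₁ hμ₂ θ₂
  have he := eps2_bandXY hμ₁ hμ₂ θ₁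
  unfold hfun SX SY
  rw [hx, hy, show bandX μ θ₁ + bandX μ θ₂ + -bandX μ θ₂ = bandX μ θ₁ by ring,
    show bandY μ θ₁ + bandY μ θ₂ + -bandY μ θ₂ = bandY μ θ₁ by ring, he, sub_self]

/-- `|x| ≤ |t|` for `x ∈ [min 0 t, max 0 t]`. [folklore] -/
theorem abs_le_of_mem_between {x t : ℝ} (h : min 0 t ≤ x ∧ x ≤ max 0 t) : |x| ≤ |t| := by
  rcases le_total 0 t with ht | ht
  · rw [min_eq_left ht, max_eq_right ht] at h; rw [abs_of_nonneg h.1, abs_of_nonneg ht]; exact h.2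
  · rw [min_eq_right ht, max_eq_left ht] at h; rw [abs_of_nonpos h.2, abs_of_nonpos ht]; linarith [h.1]

/-- Two points of `[min 0 t, max 0 t]` are within `|t|`. [folklore] -/
theorem abs_sub_le_of_mem_between {x y t : ℝ} (hx : min 0 t ≤ x ∧ x ≤ max 0 t) (hy : min 0 t ≤ y ∧ y ≤ max 0 t) :
    |x - y| ≤ |t| := by
  rcases le_total 0 t with ht | ht
  · rw [min_eq_left ht, max_eq_right ht] at hx hy; rw [abs_of_nonneg ht, abs_le]; constructor <;> linarith [hx.1, hx.2, hy.1, hy.2]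
  · rw [min_eq_right ht, max_eq_left ht] at hx hy; rw [abs_of_nonpos ht, abs_le]; constructor <;> linarith [hx.1, hx.2, hy.1, hy.2]

section Nondeg

variable {a b : ℝ} (B : BandBounds a b) {μ : ℝ} (hμ : μ ∈ Icc a b)
include hμ

omit hμ in
/-- Half of `∂₃ h`. [folklore] -/
theorem abs_half_h3_le {θ₁ θ₂ θ₃ lam : ℝ} (h : |h3 μ θ₁ θ₂ θ₃| ≤ lam) :
    |Real.sin (SX μ θ₁ θ₂ θ₃) * bandVX μ θ₃ + Real.sin (SY μ θ₁ θ₂ θ₃) * bandVY μ θ₃| ≤ lam / 2 := by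
  unfold h3 at h
  rw [show 2 * Real.sin (SX μ θ₁ θ₂ θ₃) * bandVX μ θ₃ + 2 * Real.sin (SY μ θ₁ θ₂ θ₃) * bandVY μ θ₃ =
    2 * (Real.sin (SX μ θ₁ θ₂ θ₃) * bandVX μ θ₃ + Real.sin (SY μ θ₁ θ₂ θ₃) * bandVY μ θ₃) by ring,
    abs_mul, abs_two] at h
  linarith

/-- Perturbing the `sin`-coefficients of a cross term by `e` changes it by at most `2 s_max e`. [folklore] -/
theorem cross_perturb {p q p' q' θ e : ℝ} (hp : |p - p'| ≤ e) (hq : |q - q'| ≤ e) :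
    |p' * bandVX μ θ + q' * bandVY μ θ| ≤ |p * bandVX μ θ + q * bandVY μ θ| + 2 * B.smax * e := by
  have he : 0 ≤ e := (abs_nonneg _).trans hp
  have h1 := abs_two_term_sub_le p q p' q' (bandVX μ θ) (bandVY μ θ)
  have b1 : |p - p'| * |bandVX μ θ| ≤ e * B.smax := mul_le_mul hp (B.abs_VX_le μ hμ θ) (abs_nonneg _) he
  have b2 : |q - q'| * |bandVY μ θ| ≤ e * B.smax := mul_le_mul hq (B.abs_VY_le μ hμ θ) (abs_nonneg _) he
  have h2 := abs_sub_abs_le_abs_sub (p' * bandVX μ θ + q' * bandVY μ θ) (p * bandVX μ θ + q * bandVY μ θ)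
  rw [abs_sub_comm] at h2
  linarith

/-- **Covering lemma (region `R₁`)**: if `|h| ≤ η₀` and both partial derivatives are `≤ λ` in
modulus then `θ₃ ≡ θ₂` modulo `π` up to `τ`. [folklore] -/
theorem cover {θ₁ θ₂ θ₃ η₀ lam τ : ℝ} (hlo : a ≤ μ - η₀) (hhi : μ + η₀ ≤ b)
    (hh : |hfun μ θ₁ θ₂ θ₃| ≤ η₀) (hd2 : |h3 μ θ₁ θ₃ θ₂| ≤ lam) (hd3 : |h3 μ θ₁ θ₂ θ₃| ≤ lam)
    (hsmall : 2 * (B.Cg * (lam / 2 + 2 * B.smax * (η₀ / B.Dtmin))) ≤ τ) :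
    ∃ j : ℤ, |θ₃ - θ₂ - j * π| ≤ τ := by
  have hh' : |eps2 (SX μ θ₁ θ₂ θ₃) (SY μ θ₁ θ₂ θ₃) - μ| ≤ η₀ := by unfold hfun at hh; exact hh
  obtain ⟨φ, hsx, hsy, -, -⟩ := exists_near_curve_trig B hμ hh' hlo hhi
  -- leg 3
  have k3 : |Real.sin (bandX μ φ) * bandVX μ θ₃ + Real.sin (bandY μ φ) * bandVY μ θ₃| ≤
      lam / 2 + 2 * B.smax * (η₀ / B.Dtmin) :=
    (cross_perturb B hμ hsx hsy).trans (by linarith [abs_half_h3_le hd3])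
  obtain ⟨j₃, hj₃⟩ := exists_int_near_of_cross_small B hμ k3
  -- leg 2
  have hd2' : |Real.sin (SX μ θ₁ θ₂ θ₃) * bandVX μ θ₂ + Real.sin (SY μ θ₁ θ₂ θ₃) * bandVY μ θ₂| ≤ lam / 2 := by
    have := abs_half_h3_le hd2
    rwa [← SX_swap, ← SY_swap] at this
  have k2 : |Real.sin (bandX μ φ) * bandVX μ θ₂ + Real.sin (bandY μ φ) * bandVY μ θ₂| ≤
      lam / 2 + 2 * B.smax * (η₀ / B.Dtmin) :=
    (cross_perturb B hμ hsx hsy).trans (by linarith)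
  obtain ⟨j₂, hj₂⟩ := exists_int_near_of_cross_small B hμ k2
  refine ⟨j₂ - j₃, ?_⟩
  have : θ₃ - θ₂ - ((j₂ - j₃ : ℤ) : ℝ) * π = (φ - θ₂ - j₂ * π) - (φ - θ₃ - j₃ * π) := by push_cast; ring
  rw [this]
  calc |(φ - θ₂ - j₂ * π) - (φ - θ₃ - j₃ * π)| ≤ |φ - θ₂ - j₂ * π| + |φ - θ₃ - j₃ * π| := abs_sub _ _
    _ ≤ B.Cg * (lam / 2 + 2 * B.smax * (η₀ / B.Dtmin)) + B.Cg * (lam / 2 + 2 * B.smax * (η₀ / B.Dtmin)) :=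
        add_le_add hj₂ hj₃
    _ ≤ τ := by linarith

/-- **Transversality near the Cooper line (region `R₂`, odd shift)**: for `0 < |c - π| ≤ τ`, if
`|h(θ₂, θ₂ + c)| ≤ η_o |c - π|` then the `θ₂`-derivative of `θ₂ ↦ h(θ₂, θ₂ + c)` has modulus
`≥ h_min |c - π|`. [folklore] -/
theorem odd_transversal {θ₁ θ₂ c τ ηo : ℝ} (hc : |c - π| ≤ τ) (hcπ : c ≠ π)
    (hF : |hfun μ θ₁ θ₂ (θ₂ + c)| ≤ ηo * |c - π|)
    (hsmall : 4 * B.A2 * B.smax * (2 * τ + 2 * B.Cg * B.smax ^ 2 * τ + B.Cg * (ηo / 2)) ≤ B.hmin) :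
    B.hmin * |c - π| ≤ |2 * Real.sin (SX μ θ₁ θ₂ (θ₂ + c)) * (bandVX μ θ₂ + bandVX μ (θ₂ + c)) +
        2 * Real.sin (SY μ θ₁ θ₂ (θ₂ + c)) * (bandVY μ θ₂ + bandVY μ (θ₂ + c))| := by
  obtain ⟨h1, h2⟩ := B.level hμ
  have hs := B.smax_pos; have hA := B.A2_pos; have hCg := B.Cg_pos
  set t := c - π with ht
  have hct : c = π + t := by rw [ht]; ring
  have ht0 : t ≠ 0 := fun h0 => hcπ (by linarith)
  have htabs : 0 < |t| := abs_pos.2 ht0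
  have hτ0 : 0 ≤ τ := (abs_nonneg _).trans hc
  have hηo : 0 ≤ ηo := by
    by_contra hneg; push Not at hneg
    have : ηo * |t| < 0 := mul_neg_of_neg_of_pos hneg htabs
    linarith [abs_nonneg (hfun μ θ₁ θ₂ (θ₂ + c))]
  -- Step 1: the mean value theorem in the `θ₃` slot
  obtain ⟨ξ₃, hξ₃, hslope⟩ := exists_slope (hasDerivAt_hfun_three h1 h2 θ₁ θ₂) (θ₂ + π) t
  rw [hfun_add_pi h1 h2, sub_zero, show θ₂ + π + t = θ₂ + c by rw [hct]; ring] at hslope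
  have hh3 : |h3 μ θ₁ θ₂ ξ₃| ≤ ηo := by
    have e : |hfun μ θ₁ θ₂ (θ₂ + c)| = |t| * |h3 μ θ₁ θ₂ ξ₃| := by rw [hslope, abs_mul]
    rw [e] at hF
    have : |t| * |h3 μ θ₁ θ₂ ξ₃| ≤ |t| * ηo := by linarith
    exact le_of_mul_le_mul_left this htabs
  set ts := ξ₃ - (θ₂ + π) with hts
  have hts_abs : |ts| ≤ τ := (abs_le_of_mem_between hξ₃).trans hc
  have hξ₃eq : ξ₃ = θ₂ + ts + π := by rw [hts]; ring
  obtain ⟨px, py, pvx, pvy⟩ := band_add_pi h1 h2 (θ₂ + ts)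
  rw [← hξ₃eq] at px py pvx pvy
  have hsinX : |Real.sin (SX μ θ₁ θ₂ ξ₃) - Real.sin (bandX μ θ₁)| ≤ B.smax * τ := by
    refine (Real.abs_sin_sub_sin_le _ _).trans ?_
    have : SX μ θ₁ θ₂ ξ₃ - bandX μ θ₁ = bandX μ θ₂ - bandX μ (θ₂ + ts) := by unfold SX; rw [px]; ring
    rw [this]
    refine (abs_bandX_sub_le B hμ _ _).trans ?_
    rw [show θ₂ - (θ₂ + ts) = -ts by ring, abs_neg]
    exact mul_le_mul_of_nonneg_left hts_abs hs.le
  have hsinY : |Real.sin (SY μ θ₁ θ₂ ξ₃) - Real.sin (bandY μ θ₁)| ≤ B.smax * τ := by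
    refine (Real.abs_sin_sub_sin_le _ _).trans ?_
    have : SY μ θ₁ θ₂ ξ₃ - bandY μ θ₁ = bandY μ θ₂ - bandY μ (θ₂ + ts) := by unfold SY; rw [py]; ring
    rw [this]
    refine (abs_bandY_sub_le B hμ _ _).trans ?_
    rw [show θ₂ - (θ₂ + ts) = -ts by ring, abs_neg]
    exact mul_le_mul_of_nonneg_left hts_abs hs.le
  have hAux : |Real.sin (SX μ θ₁ θ₂ ξ₃) * bandVX μ (θ₂ + ts) + Real.sin (SY μ θ₁ θ₂ ξ₃) * bandVY μ (θ₂ + ts)| ≤ ηo / 2 := by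
    unfold h3 at hh3
    rw [pvx, pvy, show 2 * Real.sin (SX μ θ₁ θ₂ ξ₃) * -bandVX μ (θ₂ + ts) + 2 * Real.sin (SY μ θ₁ θ₂ ξ₃) * -bandVY μ (θ₂ + ts)
      = (-2) * (Real.sin (SX μ θ₁ θ₂ ξ₃) * bandVX μ (θ₂ + ts) + Real.sin (SY μ θ₁ θ₂ ξ₃) * bandVY μ (θ₂ + ts)) by ring,
      abs_mul, show |(-2 : ℝ)| = 2 by norm_num] at hh3
    linarith
  have k1 : |Real.sin (bandX μ θ₁) * bandVX μ (θ₂ + ts) + Real.sin (bandY μ θ₁) * bandVY μ (θ₂ + ts)| ≤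
      ηo / 2 + 2 * B.smax * (B.smax * τ) := (cross_perturb B hμ hsinX hsinY).trans (by linarith)
  obtain ⟨j, hj⟩ := exists_int_near_of_cross_small B hμ k1
  -- Step 2: the mean value theorem for the frozen-coefficient function
  set Sx := SX μ θ₁ θ₂ (θ₂ + c) with hSx
  set Sy := SY μ θ₁ θ₂ (θ₂ + c) with hSy
  have hfd : ∀ x, HasDerivAt (fun x => 2 * Real.sin Sx * bandVX μ x + 2 * Real.sin Sy * bandVY μ x)
      (2 * Real.sin Sx * bandAX μ x + 2 * Real.sin Sy * bandAY μ x) x := fun x =>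
    ((hasDerivAt_bandVX h1 h2 x).const_mul (2 * Real.sin Sx)).fun_add
      ((hasDerivAt_bandVY h1 h2 x).const_mul (2 * Real.sin Sy))
  obtain ⟨ξ, hξ, hslope2⟩ := exists_slope hfd θ₂ t
  obtain ⟨qx, qy, qvx, qvy⟩ := band_add_pi h1 h2 (θ₂ + t)
  have hθc : θ₂ + c = θ₂ + t + π := by rw [hct]; ring
  have hD : 2 * Real.sin Sx * (bandVX μ θ₂ + bandVX μ (θ₂ + c)) + 2 * Real.sin Sy * (bandVY μ θ₂ + bandVY μ (θ₂ + c)) =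
      -(t * (2 * Real.sin Sx * bandAX μ ξ + 2 * Real.sin Sy * bandAY μ ξ)) := by
    rw [← hslope2, hθc, qvx, qvy]; ring
  have hsinSx : |Real.sin Sx - Real.sin (bandX μ θ₁)| ≤ B.smax * τ := by
    refine (Real.abs_sin_sub_sin_le _ _).trans ?_
    have : Sx - bandX μ θ₁ = bandX μ θ₂ - bandX μ (θ₂ + t) := by rw [hSx]; unfold SX; rw [hθc, qx]; ring
    rw [this]
    refine (abs_bandX_sub_le B hμ _ _).trans ?_
    rw [show θ₂ - (θ₂ + t) = -t by ring, abs_neg]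
    exact mul_le_mul_of_nonneg_left hc hs.le
  have hsinSy : |Real.sin Sy - Real.sin (bandY μ θ₁)| ≤ B.smax * τ := by
    refine (Real.abs_sin_sub_sin_le _ _).trans ?_
    have : Sy - bandY μ θ₁ = bandY μ θ₂ - bandY μ (θ₂ + t) := by rw [hSy]; unfold SY; rw [hθc, qy]; ring
    rw [this]
    refine (abs_bandY_sub_le B hμ _ _).trans ?_
    rw [show θ₂ - (θ₂ + t) = -t by ring, abs_neg]
    exact mul_le_mul_of_nonneg_left hc hs.le
  -- align `θ₁` with `ξ`
  set ε₂ := B.Cg * (ηo / 2 + 2 * B.smax * (B.smax * τ)) + τ with hε₂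
  have halign : |θ₁ - ξ - j * π| ≤ ε₂ := by
    have hξts : |θ₂ + ts - ξ| ≤ |t| := by
      have := abs_sub_le_of_mem_between hξ₃ hξ
      rw [show ξ₃ - (θ₂ + π) - (ξ - θ₂) = θ₂ + ts - ξ by rw [hts]; ring] at this
      exact this
    calc |θ₁ - ξ - j * π| = |(θ₁ - (θ₂ + ts) - j * π) + (θ₂ + ts - ξ)| := by ring_nf
      _ ≤ |θ₁ - (θ₂ + ts) - j * π| + |θ₂ + ts - ξ| := abs_add_le _ _
      _ ≤ B.Cg * (ηo / 2 + 2 * B.smax * (B.smax * τ)) + |t| := add_le_add hj hξts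
      _ ≤ ε₂ := by rw [hε₂]; linarith
  obtain ⟨σ, hσ, ax, ay, -, -⟩ := exists_sign_align B hμ halign
  have hσabs : |σ| = 1 := by rcases hσ with rfl | rfl <;> norm_num
  have hε₂0 : 0 ≤ ε₂ := (abs_nonneg _).trans halign
  have cx : |σ * Real.sin Sx - Real.sin (bandX μ ξ)| ≤ B.smax * τ + B.smax * ε₂ := by
    calc |σ * Real.sin Sx - Real.sin (bandX μ ξ)|
        = |σ * (Real.sin Sx - Real.sin (bandX μ θ₁)) + (σ * Real.sin (bandX μ θ₁) - Real.sin (bandX μ ξ))| := by ring_nf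
      _ ≤ |σ * (Real.sin Sx - Real.sin (bandX μ θ₁))| + |σ * Real.sin (bandX μ θ₁) - Real.sin (bandX μ ξ)| := abs_add_le _ _
      _ ≤ B.smax * τ + B.smax * ε₂ := by rw [abs_mul, hσabs, one_mul]; exact add_le_add hsinSx ax
  have cy : |σ * Real.sin Sy - Real.sin (bandY μ ξ)| ≤ B.smax * τ + B.smax * ε₂ := by
    calc |σ * Real.sin Sy - Real.sin (bandY μ ξ)|
        = |σ * (Real.sin Sy - Real.sin (bandY μ θ₁)) + (σ * Real.sin (bandY μ θ₁) - Real.sin (bandY μ ξ))| := by ring_nf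
      _ ≤ |σ * (Real.sin Sy - Real.sin (bandY μ θ₁))| + |σ * Real.sin (bandY μ θ₁) - Real.sin (bandY μ ξ)| := abs_add_le _ _
      _ ≤ B.smax * τ + B.smax * ε₂ := by rw [abs_mul, hσabs, one_mul]; exact add_le_add hsinSy ay
  -- the core lower bound through the Hessian at `ξ`
  have hHess := B.hess_ge μ hμ ξ
  have hid := sin_mul_acc_eq_neg_hess h1 h2 ξ
  have hR := abs_two_term_sub_le (σ * Real.sin Sx) (σ * Real.sin Sy) (Real.sin (bandX μ ξ)) (Real.sin (bandY μ ξ))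
    (bandAX μ ξ) (bandAY μ ξ)
  have bR1 : |σ * Real.sin Sx - Real.sin (bandX μ ξ)| * |bandAX μ ξ| ≤ (B.smax * τ + B.smax * ε₂) * B.A2 :=
    mul_le_mul cx (B.abs_AX_le μ hμ ξ) (abs_nonneg _) (by positivity)
  have bR2 : |σ * Real.sin Sy - Real.sin (bandY μ ξ)| * |bandAY μ ξ| ≤ (B.smax * τ + B.smax * ε₂) * B.A2 :=
    mul_le_mul cy (B.abs_AY_le μ hμ ξ) (abs_nonneg _) (by positivity)
  have hcore : B.hmin / 2 ≤ |Real.sin Sx * bandAX μ ξ + Real.sin Sy * bandAY μ ξ| := by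
    have e1 : |σ * Real.sin Sx * bandAX μ ξ + σ * Real.sin Sy * bandAY μ ξ| = |Real.sin Sx * bandAX μ ξ + Real.sin Sy * bandAY μ ξ| := by
      rw [show σ * Real.sin Sx * bandAX μ ξ + σ * Real.sin Sy * bandAY μ ξ =
        σ * (Real.sin Sx * bandAX μ ξ + Real.sin Sy * bandAY μ ξ) by ring, abs_mul, hσabs, one_mul]
    have e2 := abs_sub_abs_le_abs_sub (Real.sin (bandX μ ξ) * bandAX μ ξ + Real.sin (bandY μ ξ) * bandAY μ ξ)
      (σ * Real.sin Sx * bandAX μ ξ + σ * Real.sin Sy * bandAY μ ξ)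
    rw [abs_sub_comm] at e2
    have e3 : |Real.sin (bandX μ ξ) * bandAX μ ξ + Real.sin (bandY μ ξ) * bandAY μ ξ| =
        Real.cos (bandX μ ξ) * bandVX μ ξ ^ 2 + Real.cos (bandY μ ξ) * bandVY μ ξ ^ 2 := by
      rw [hid, abs_neg, abs_of_pos (lt_of_lt_of_le B.hmin_pos hHess)]
    -- smallness: `2 A (sτ + sε₂) ≤ h_min / 2`
    have hsm : 2 * ((B.smax * τ + B.smax * ε₂) * B.A2) ≤ B.hmin / 2 := by
      have : 2 * ((B.smax * τ + B.smax * ε₂) * B.A2) =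
          (4 * B.A2 * B.smax * (2 * τ + 2 * B.Cg * B.smax ^ 2 * τ + B.Cg * (ηo / 2))) / 2 := by
        rw [hε₂]; ring
      rw [this]; linarith [hsmall]
    rw [← e1]
    linarith
  have hfin : 2 * Real.sin Sx * bandAX μ ξ + 2 * Real.sin Sy * bandAY μ ξ =
      2 * (Real.sin Sx * bandAX μ ξ + Real.sin Sy * bandAY μ ξ) := by ring
  rw [hD, abs_neg, abs_mul, hfin, abs_mul, abs_two]
  have := mul_le_mul_of_nonneg_left hcore (abs_nonneg t)
  linarith

/-- **The fold-in-`t` key lower bound (region `R₂`, even shift)**: on the anti-diagonal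
`(σ - t/2, σ + t/2)`, `0 < t ≤ τ`, if `|h| ≤ η₀` and `|G| ≤ 4λ` then `|∂_t ĥ| ≥ (h_min/2) t`. [folklore] -/
theorem even_key {θ₁ σ t τ η₀ lam : ℝ} (ht0 : 0 < t) (htτ : t ≤ τ) (hlo : a ≤ μ - η₀) (hhi : μ + η₀ ≤ b)
    (hh : |hfun μ θ₁ (σ - t / 2) (σ + t / 2)| ≤ η₀) (hG : |Gfun μ θ₁ σ t| ≤ 4 * lam)
    (hsmall : 2 * B.A2 * (η₀ / B.Dtmin + B.smax * (B.Cg * (lam + B.A2 * τ + 2 * B.smax * (η₀ / B.Dtmin)) + τ / 2)) ≤ B.hmin / 2) :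
    B.hmin / 2 * t ≤ |Real.sin (SX μ θ₁ (σ - t / 2) (σ + t / 2)) * (bandVX μ (σ + t / 2) - bandVX μ (σ - t / 2)) +
        Real.sin (SY μ θ₁ (σ - t / 2) (σ + t / 2)) * (bandVY μ (σ + t / 2) - bandVY μ (σ - t / 2))| := by
  obtain ⟨h1, h2⟩ := B.level hμ
  have hs := B.smax_pos; have hA := B.A2_pos; have hCg := B.Cg_pos; have hD := B.Dtmin_pos
  have hη₀ : 0 ≤ η₀ := (abs_nonneg _).trans hh
  have hlam : 0 ≤ lam := by linarith [abs_nonneg (Gfun μ θ₁ σ t)]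
  have hτ : 0 < τ := ht0.trans_le htτ
  set Sx := SX μ θ₁ (σ - t / 2) (σ + t / 2) with hSx
  set Sy := SY μ θ₁ (σ - t / 2) (σ + t / 2) with hSy
  have hh' : |eps2 Sx Sy - μ| ≤ η₀ := by unfold hfun at hh; exact hh
  obtain ⟨φ, hsx, hsy, -, -⟩ := exists_near_curve_trig B hμ hh' hlo hhi
  -- `|sin Sx X'(σ) + sin Sy Y'(σ)| ≤ λ + A τ`
  have hvm := abs_bandVX_sub_le B hμ (σ - t / 2) σ
  have hvp := abs_bandVX_sub_le B hμ (σ + t / 2) σ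
  have hwm := abs_bandVY_sub_le B hμ (σ - t / 2) σ
  have hwp := abs_bandVY_sub_le B hμ (σ + t / 2) σ
  rw [show σ - t / 2 - σ = -(t / 2) by ring, abs_neg, abs_of_pos (by linarith : 0 < t / 2)] at hvm hwm
  rw [show σ + t / 2 - σ = t / 2 by ring, abs_of_pos (by linarith : 0 < t / 2)] at hvp hwp
  have hmid : |Real.sin Sx * bandVX μ σ + Real.sin Sy * bandVY μ σ| ≤ lam + B.A2 * τ := by
    have hG' : |Real.sin Sx * (bandVX μ (σ - t / 2) + bandVX μ (σ + t / 2)) +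
        Real.sin Sy * (bandVY μ (σ - t / 2) + bandVY μ (σ + t / 2))| ≤ 2 * lam := by
      unfold Gfun at hG
      rw [show 2 * (Real.sin Sx * (bandVX μ (σ - t / 2) + bandVX μ (σ + t / 2))) +
          2 * (Real.sin Sy * (bandVY μ (σ - t / 2) + bandVY μ (σ + t / 2))) =
          2 * (Real.sin Sx * (bandVX μ (σ - t / 2) + bandVX μ (σ + t / 2)) +
            Real.sin Sy * (bandVY μ (σ - t / 2) + bandVY μ (σ + t / 2))) by ring, abs_mul, abs_two] at hG
      linarith
    have hdiff : |Real.sin Sx * (bandVX μ (σ - t / 2) + bandVX μ (σ + t / 2)) +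
        Real.sin Sy * (bandVY μ (σ - t / 2) + bandVY μ (σ + t / 2)) -
        2 * (Real.sin Sx * bandVX μ σ + Real.sin Sy * bandVY μ σ)| ≤ B.A2 * t + B.A2 * t := by
      rw [show Real.sin Sx * (bandVX μ (σ - t / 2) + bandVX μ (σ + t / 2)) +
        Real.sin Sy * (bandVY μ (σ - t / 2) + bandVY μ (σ + t / 2)) -
        2 * (Real.sin Sx * bandVX μ σ + Real.sin Sy * bandVY μ σ) =
        Real.sin Sx * ((bandVX μ (σ - t / 2) - bandVX μ σ) + (bandVX μ (σ + t / 2) - bandVX μ σ)) +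
        Real.sin Sy * ((bandVY μ (σ - t / 2) - bandVY μ σ) + (bandVY μ (σ + t / 2) - bandVY μ σ)) by ring]
      refine (abs_two_term_le (Real.abs_sin_le_one _) ((abs_add_le _ _).trans (add_le_add hvm hvp))
        (Real.abs_sin_le_one _) ((abs_add_le _ _).trans (add_le_add hwm hwp))).trans ?_
      linarith
    have := abs_sub_abs_le_abs_sub (2 * (Real.sin Sx * bandVX μ σ + Real.sin Sy * bandVY μ σ))
      (Real.sin Sx * (bandVX μ (σ - t / 2) + bandVX μ (σ + t / 2)) + Real.sin Sy * (bandVY μ (σ - t / 2) + bandVY μ (σ + t / 2)))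
    rw [abs_sub_comm] at this
    rw [abs_mul, abs_two] at this
    nlinarith
  have k1 : |Real.sin (bandX μ φ) * bandVX μ σ + Real.sin (bandY μ φ) * bandVY μ σ| ≤
      lam + B.A2 * τ + 2 * B.smax * (η₀ / B.Dtmin) := (cross_perturb B hμ hsx hsy).trans (by linarith)
  obtain ⟨j, hj⟩ := exists_int_near_of_cross_small B hμ k1
  -- MVT for the frozen-coefficient function on `[σ - t/2, σ + t/2]`
  have hfd : ∀ x, HasDerivAt (fun x => Real.sin Sx * bandVX μ x + Real.sin Sy * bandVY μ x)
      (Real.sin Sx * bandAX μ x + Real.sin Sy * bandAY μ x) x := fun x =>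
    ((hasDerivAt_bandVX h1 h2 x).const_mul (Real.sin Sx)).fun_add ((hasDerivAt_bandVY h1 h2 x).const_mul (Real.sin Sy))
  obtain ⟨ξ, hξ, hslope⟩ := exists_slope hfd (σ - t / 2) t
  rw [show σ - t / 2 + t = σ + t / 2 by ring] at hslope
  have hval : Real.sin Sx * (bandVX μ (σ + t / 2) - bandVX μ (σ - t / 2)) +
      Real.sin Sy * (bandVY μ (σ + t / 2) - bandVY μ (σ - t / 2)) = t * (Real.sin Sx * bandAX μ ξ + Real.sin Sy * bandAY μ ξ) := by
    rw [← hslope]; ring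
  have hξσ : |ξ - σ| ≤ τ / 2 := by
    rw [min_eq_left ht0.le, max_eq_right ht0.le] at hξ
    rw [abs_le]; constructor <;> linarith [hξ.1, hξ.2]
  set ε₂ := B.Cg * (lam + B.A2 * τ + 2 * B.smax * (η₀ / B.Dtmin)) + τ / 2 with hε₂
  have halign : |φ - ξ - j * π| ≤ ε₂ := by
    calc |φ - ξ - j * π| = |(φ - σ - j * π) + (σ - ξ)| := by ring_nf
      _ ≤ |φ - σ - j * π| + |σ - ξ| := abs_add_le _ _
      _ ≤ B.Cg * (lam + B.A2 * τ + 2 * B.smax * (η₀ / B.Dtmin)) + τ / 2 := add_le_add hj (by rw [abs_sub_comm]; exact hξσ)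
  obtain ⟨σ', hσ', ax, ay, -, -⟩ := exists_sign_align B hμ halign
  have hσabs : |σ'| = 1 := by rcases hσ' with rfl | rfl <;> norm_num
  set ε₃ := η₀ / B.Dtmin + B.smax * ε₂ with hε₃
  have cx : |σ' * Real.sin Sx - Real.sin (bandX μ ξ)| ≤ ε₃ := by
    calc |σ' * Real.sin Sx - Real.sin (bandX μ ξ)|
        = |σ' * (Real.sin Sx - Real.sin (bandX μ φ)) + (σ' * Real.sin (bandX μ φ) - Real.sin (bandX μ ξ))| := by ring_nf
      _ ≤ |σ' * (Real.sin Sx - Real.sin (bandX μ φ))| + |σ' * Real.sin (bandX μ φ) - Real.sin (bandX μ ξ)| := abs_add_le _ _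
      _ ≤ η₀ / B.Dtmin + B.smax * ε₂ := by rw [abs_mul, hσabs, one_mul]; exact add_le_add hsx ax
  have cy : |σ' * Real.sin Sy - Real.sin (bandY μ ξ)| ≤ ε₃ := by
    calc |σ' * Real.sin Sy - Real.sin (bandY μ ξ)|
        = |σ' * (Real.sin Sy - Real.sin (bandY μ φ)) + (σ' * Real.sin (bandY μ φ) - Real.sin (bandY μ ξ))| := by ring_nf
      _ ≤ |σ' * (Real.sin Sy - Real.sin (bandY μ φ))| + |σ' * Real.sin (bandY μ φ) - Real.sin (bandY μ ξ)| := abs_add_le _ _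
      _ ≤ η₀ / B.Dtmin + B.smax * ε₂ := by rw [abs_mul, hσabs, one_mul]; exact add_le_add hsy ay
  have hHess := B.hess_ge μ hμ ξ
  have hid := sin_mul_acc_eq_neg_hess h1 h2 ξ
  have hR := abs_two_term_sub_le (σ' * Real.sin Sx) (σ' * Real.sin Sy) (Real.sin (bandX μ ξ)) (Real.sin (bandY μ ξ))
    (bandAX μ ξ) (bandAY μ ξ)
  have hε₃0 : 0 ≤ ε₃ := (abs_nonneg _).trans cx
  have bR1 : |σ' * Real.sin Sx - Real.sin (bandX μ ξ)| * |bandAX μ ξ| ≤ ε₃ * B.A2 :=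
    mul_le_mul cx (B.abs_AX_le μ hμ ξ) (abs_nonneg _) hε₃0
  have bR2 : |σ' * Real.sin Sy - Real.sin (bandY μ ξ)| * |bandAY μ ξ| ≤ ε₃ * B.A2 :=
    mul_le_mul cy (B.abs_AY_le μ hμ ξ) (abs_nonneg _) hε₃0
  have hcore : B.hmin / 2 ≤ |Real.sin Sx * bandAX μ ξ + Real.sin Sy * bandAY μ ξ| := by
    have e1 : |σ' * Real.sin Sx * bandAX μ ξ + σ' * Real.sin Sy * bandAY μ ξ| = |Real.sin Sx * bandAX μ ξ + Real.sin Sy * bandAY μ ξ| := by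
      rw [show σ' * Real.sin Sx * bandAX μ ξ + σ' * Real.sin Sy * bandAY μ ξ =
        σ' * (Real.sin Sx * bandAX μ ξ + Real.sin Sy * bandAY μ ξ) by ring, abs_mul, hσabs, one_mul]
    have e2 := abs_sub_abs_le_abs_sub (Real.sin (bandX μ ξ) * bandAX μ ξ + Real.sin (bandY μ ξ) * bandAY μ ξ)
      (σ' * Real.sin Sx * bandAX μ ξ + σ' * Real.sin Sy * bandAY μ ξ)
    rw [abs_sub_comm] at e2
    have e3 : |Real.sin (bandX μ ξ) * bandAX μ ξ + Real.sin (bandY μ ξ) * bandAY μ ξ| =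
        Real.cos (bandX μ ξ) * bandVX μ ξ ^ 2 + Real.cos (bandY μ ξ) * bandVY μ ξ ^ 2 := by
      rw [hid, abs_neg, abs_of_pos (lt_of_lt_of_le B.hmin_pos hHess)]
    have hsm : 2 * (ε₃ * B.A2) ≤ B.hmin / 2 := by linarith [hsmall]
    rw [← e1]
    linarith
  rw [hval, abs_mul, abs_of_pos ht0]
  have := mul_le_mul_of_nonneg_left hcore ht0.le
  linarith

/-- **Stratified non-degeneracy of the diagonal function** `H(σ) = h(σ, σ)`: if `|H| ≤ η₀` and
`|H'| ≤ η₁` then `H'' ≥ 2 h_min`. [folklore] -/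
theorem diag_strat {θ₁ σ η₀ η₁ : ℝ} (hlo : a ≤ μ - η₀) (hhi : μ + η₀ ≤ b)
    (hH : |hfun μ θ₁ σ σ| ≤ η₀)
    (hH' : |4 * (Real.sin (SX μ θ₁ σ σ) * bandVX μ σ + Real.sin (SY μ θ₁ σ σ) * bandVY μ σ)| ≤ η₁)
    (hsmall : (16 * B.smax ^ 2 + 8 * B.A2) * (η₀ / B.Dtmin + B.smax * (B.Cg * (η₁ / 4 + 2 * B.smax * (η₀ / B.Dtmin)))) ≤ 2 * B.hmin) :
    2 * B.hmin ≤ 8 * (Real.cos (SX μ θ₁ σ σ) * bandVX μ σ ^ 2 + Real.cos (SY μ θ₁ σ σ) * bandVY μ σ ^ 2) +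
      4 * (Real.sin (SX μ θ₁ σ σ) * bandAX μ σ + Real.sin (SY μ θ₁ σ σ) * bandAY μ σ) := by
  obtain ⟨h1, h2⟩ := B.level hμ
  have hs := B.smax_pos; have hA := B.A2_pos; have hCg := B.Cg_pos; have hD := B.Dtmin_pos
  set Sx := SX μ θ₁ σ σ with hSx
  set Sy := SY μ θ₁ σ σ with hSy
  have hh' : |eps2 Sx Sy - μ| ≤ η₀ := by unfold hfun at hH; exact hH
  obtain ⟨φ, hsx, hsy, hcx, hcy⟩ := exists_near_curve_trig B hμ hh' hlo hhi
  have hmid : |Real.sin Sx * bandVX μ σ + Real.sin Sy * bandVY μ σ| ≤ η₁ / 4 := by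
    rw [abs_mul, show |(4:ℝ)| = 4 by norm_num] at hH'; linarith
  have k1 : |Real.sin (bandX μ φ) * bandVX μ σ + Real.sin (bandY μ φ) * bandVY μ σ| ≤
      η₁ / 4 + 2 * B.smax * (η₀ / B.Dtmin) := (cross_perturb B hμ hsx hsy).trans (by linarith)
  obtain ⟨j, hj⟩ := exists_int_near_of_cross_small B hμ k1
  obtain ⟨σ', hσ', ax, ay, bx, bY⟩ := exists_sign_align B hμ hj
  have hσabs : |σ'| = 1 := by rcases hσ' with rfl | rfl <;> norm_num
  set ε₃ := η₀ / B.Dtmin + B.smax * (B.Cg * (η₁ / 4 + 2 * B.smax * (η₀ / B.Dtmin))) with hε₃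
  have cx : |σ' * Real.sin Sx - Real.sin (bandX μ σ)| ≤ ε₃ := by
    calc |σ' * Real.sin Sx - Real.sin (bandX μ σ)|
        = |σ' * (Real.sin Sx - Real.sin (bandX μ φ)) + (σ' * Real.sin (bandX μ φ) - Real.sin (bandX μ σ))| := by ring_nf
      _ ≤ |σ' * (Real.sin Sx - Real.sin (bandX μ φ))| + |σ' * Real.sin (bandX μ φ) - Real.sin (bandX μ σ)| := abs_add_le _ _
      _ ≤ ε₃ := by rw [abs_mul, hσabs, one_mul]; exact add_le_add hsx ax
  have cy : |σ' * Real.sin Sy - Real.sin (bandY μ σ)| ≤ ε₃ := by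
    calc |σ' * Real.sin Sy - Real.sin (bandY μ σ)|
        = |σ' * (Real.sin Sy - Real.sin (bandY μ φ)) + (σ' * Real.sin (bandY μ φ) - Real.sin (bandY μ σ))| := by ring_nf
      _ ≤ |σ' * (Real.sin Sy - Real.sin (bandY μ φ))| + |σ' * Real.sin (bandY μ φ) - Real.sin (bandY μ σ)| := abs_add_le _ _
      _ ≤ ε₃ := by rw [abs_mul, hσabs, one_mul]; exact add_le_add hsy ay
  have dx : |Real.cos Sx - Real.cos (bandX μ σ)| ≤ ε₃ := by
    calc |Real.cos Sx - Real.cos (bandX μ σ)| = |(Real.cos Sx - Real.cos (bandX μ φ)) + (Real.cos (bandX μ φ) - Real.cos (bandX μ σ))| := by ring_nf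
      _ ≤ |Real.cos Sx - Real.cos (bandX μ φ)| + |Real.cos (bandX μ φ) - Real.cos (bandX μ σ)| := abs_add_le _ _
      _ ≤ ε₃ := add_le_add hcx bx
  have dy : |Real.cos Sy - Real.cos (bandY μ σ)| ≤ ε₃ := by
    calc |Real.cos Sy - Real.cos (bandY μ σ)| = |(Real.cos Sy - Real.cos (bandY μ φ)) + (Real.cos (bandY μ φ) - Real.cos (bandY μ σ))| := by ring_nf
      _ ≤ |Real.cos Sy - Real.cos (bandY μ φ)| + |Real.cos (bandY μ φ) - Real.cos (bandY μ σ)| := abs_add_le _ _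
      _ ≤ ε₃ := add_le_add hcy bY
  have hε₃0 : 0 ≤ ε₃ := (abs_nonneg _).trans cx
  have hHess := B.hess_ge μ hμ σ
  have hid := sin_mul_acc_eq_neg_hess h1 h2 σ
  set Hs := Real.cos (bandX μ σ) * bandVX μ σ ^ 2 + Real.cos (bandY μ σ) * bandVY μ σ ^ 2 with hHs
  -- the `cos`-part
  have hvx := B.abs_VX_le μ hμ σ; have hvy := B.abs_VY_le μ hμ σ
  have hsq1 : |bandVX μ σ ^ 2| ≤ B.smax ^ 2 := by rw [abs_pow, sq, sq]; exact mul_le_mul hvx hvx (abs_nonneg _) hs.le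
  have hsq2 : |bandVY μ σ ^ 2| ≤ B.smax ^ 2 := by rw [abs_pow, sq, sq]; exact mul_le_mul hvy hvy (abs_nonneg _) hs.le
  have R1 := abs_two_term_sub_le (Real.cos Sx) (Real.cos Sy) (Real.cos (bandX μ σ)) (Real.cos (bandY μ σ))
    (bandVX μ σ ^ 2) (bandVY μ σ ^ 2)
  have bR1 : |Real.cos Sx - Real.cos (bandX μ σ)| * |bandVX μ σ ^ 2| ≤ ε₃ * B.smax ^ 2 :=
    mul_le_mul dx hsq1 (abs_nonneg _) hε₃0
  have bR2 : |Real.cos Sy - Real.cos (bandY μ σ)| * |bandVY μ σ ^ 2| ≤ ε₃ * B.smax ^ 2 :=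
    mul_le_mul dy hsq2 (abs_nonneg _) hε₃0
  have part1 : 8 * Hs - 16 * B.smax ^ 2 * ε₃ ≤ 8 * (Real.cos Sx * bandVX μ σ ^ 2 + Real.cos Sy * bandVY μ σ ^ 2) := by
    have := (abs_le.1 (R1.trans (add_le_add bR1 bR2))).1
    rw [hHs]; linarith
  -- the `sin`-part
  have R2 := abs_two_term_sub_le (σ' * Real.sin Sx) (σ' * Real.sin Sy) (Real.sin (bandX μ σ)) (Real.sin (bandY μ σ))
    (bandAX μ σ) (bandAY μ σ)
  have bR3 : |σ' * Real.sin Sx - Real.sin (bandX μ σ)| * |bandAX μ σ| ≤ ε₃ * B.A2 :=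
    mul_le_mul cx (B.abs_AX_le μ hμ σ) (abs_nonneg _) hε₃0
  have bR4 : |σ' * Real.sin Sy - Real.sin (bandY μ σ)| * |bandAY μ σ| ≤ ε₃ * B.A2 :=
    mul_le_mul cy (B.abs_AY_le μ hμ σ) (abs_nonneg _) hε₃0
  have part2 : -4 * Hs - 8 * B.A2 * ε₃ ≤ 4 * (Real.sin Sx * bandAX μ σ + Real.sin Sy * bandAY μ σ) := by
    have hb := abs_le.1 (R2.trans (add_le_add bR3 bR4))
    -- `σ' (sin Sx AX + sin Sy AY) ≥ -Hs - 2 A ε₃`, and `σ' = ±1`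
    have hHs_pos : 0 < Hs := lt_of_lt_of_le B.hmin_pos hHess
    rcases hσ' with rfl | rfl
    · simp only [one_mul] at hb; linarith [hb.1, hb.2]
    · simp only [neg_one_mul] at hb; linarith [hb.1, hb.2]
  have hsm : (16 * B.smax ^ 2 + 8 * B.A2) * ε₃ ≤ 2 * B.hmin := hsmall
  linarith [part1, part2, hHess, hsm]

end Nondeg

/-! ## Cell geometry and the elimination of the fourth leg -/

section Cell

variable {a b : ℝ} (B : BandBounds a b) {μ : ℝ} (hμ : μ ∈ Icc a b)
include B hμ

/-- **Cell geometry (whole band)**: a momentum `k` of the open square in the shell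
`|ε(k) - μ| ≤ w`, `w = π/2ⁿ ≤ m₀` (`μ ± m₀` in the level range), whose polar angle lies in the
sector `ω`, is within `D w` of the curve point `p_μ(θ_ω)` at the sector centre, coordinatewise
(BGM 2003 Lemmas 7.2–7.3 on the band Fermi curve). [folklore] -/
theorem cell {k : Fin 2 → ℝ} {n ω : ℕ} {m₀ : ℝ} (hk : ∀ i, |k i| < π)
    (hshell : |sqDispersion k - μ| ≤ sectorWidth n) (hw : sectorWidth n ≤ m₀)
    (hlo : a ≤ μ - m₀) (hhi : μ + m₀ ≤ b)
    (hω : sectorIndex n (Complex.arg (⟨k 0, k 1⟩ : ℂ)) = ω) :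
    |k 0 - bandX μ (sectorCenter n ω)| ≤ B.Dcell * sectorWidth n ∧
      |k 1 - bandY μ (sectorCenter n ω)| ≤ B.Dcell * sectorWidth n := by
  obtain ⟨h1, h2⟩ := B.level hμ
  set w := sectorWidth n with hwdef
  have hw0 : 0 < w := sectorWidth_pos n
  set ν := sqDispersion k with hν
  have hνeq : eps2 (k 0) (k 1) = ν := by simp [hν, sqDispersion, eps2]
  have hνmem : ν ∈ Icc a b := by
    have := abs_le.1 hshell; constructor <;> linarith
  obtain ⟨hν₁, hν₂⟩ := B.level hνmem
  obtain ⟨hx, hy⟩ := band_eq_of_level hν₁ hν₂ (hk 0).le (hk 1).le hνeq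
  set φ := Complex.arg (⟨k 0, k 1⟩ : ℂ) with hφ
  -- radial deviation
  have hrad := abs_bandFermiRadius_level_sub_le B hνmem hμ φ
  have hνμ : |ν - μ| ≤ w := hshell
  have hradX : |bandX ν φ - bandX μ φ| ≤ w / B.Dtmin := by
    calc |bandX ν φ - bandX μ φ| = |bandFermiRadius ν φ - bandFermiRadius μ φ| * |Real.cos φ| := by
          rw [bandX, bandX, ← sub_mul, abs_mul]
      _ ≤ |bandFermiRadius ν φ - bandFermiRadius μ φ| := mul_le_of_le_one_right (abs_nonneg _) (Real.abs_cos_le_one φ)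
      _ ≤ |ν - μ| / B.Dtmin := hrad
      _ ≤ w / B.Dtmin := div_le_div_of_nonneg_right hνμ B.Dtmin_pos.le
  have hradY : |bandY ν φ - bandY μ φ| ≤ w / B.Dtmin := by
    calc |bandY ν φ - bandY μ φ| = |bandFermiRadius ν φ - bandFermiRadius μ φ| * |Real.sin φ| := by
          rw [bandY, bandY, ← sub_mul, abs_mul]
      _ ≤ |bandFermiRadius ν φ - bandFermiRadius μ φ| := mul_le_of_le_one_right (abs_nonneg _) (Real.abs_sin_le_one φ)
      _ ≤ |ν - μ| / B.Dtmin := hrad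
      _ ≤ w / B.Dtmin := div_le_div_of_nonneg_right hνμ B.Dtmin_pos.le
  -- angular deviation
  obtain ⟨m, hm⟩ := exists_angleRep_eq_add φ
  have hcen := abs_angleRep_sub_sectorCenter_le n φ
  rw [hω] at hcen
  have hper := band_add_int_mul_two_pi h1 h2 φ m
  rw [← hm] at hper
  have hangX : |bandX μ φ - bandX μ (sectorCenter n ω)| ≤ B.smax * (w / 2) := by
    rw [← hper.1]
    exact (abs_bandX_sub_le B hμ _ _).trans (mul_le_mul_of_nonneg_left hcen B.smax_pos.le)
  have hangY : |bandY μ φ - bandY μ (sectorCenter n ω)| ≤ B.smax * (w / 2) := by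
    rw [← hper.2.1]
    exact (abs_bandY_sub_le B hμ _ _).trans (mul_le_mul_of_nonneg_left hcen B.smax_pos.le)
  have hD : w / B.Dtmin + B.smax * (w / 2) = B.Dcell * w := by unfold BandBounds.Dcell; ring
  constructor
  · calc |k 0 - bandX μ (sectorCenter n ω)| = |(bandX ν φ - bandX μ φ) + (bandX μ φ - bandX μ (sectorCenter n ω))| := by
          rw [hx]; ring_nf
      _ ≤ |bandX ν φ - bandX μ φ| + |bandX μ φ - bandX μ (sectorCenter n ω)| := abs_add_le _ _
      _ ≤ w / B.Dtmin + B.smax * (w / 2) := add_le_add hradX hangX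
      _ = B.Dcell * w := hD
  · calc |k 1 - bandY μ (sectorCenter n ω)| = |(bandY ν φ - bandY μ φ) + (bandY μ φ - bandY μ (sectorCenter n ω))| := by
          rw [hy]; ring_nf
      _ ≤ |bandY ν φ - bandY μ φ| + |bandY μ φ - bandY μ (sectorCenter n ω)| := abs_add_le _ _
      _ ≤ w / B.Dtmin + B.smax * (w / 2) := add_le_add hradY hangY
      _ = B.Dcell * w := hD

/-- **Chord bound**: `4 u_min² sin²((θ - θ')/2) ≤ |p(θ) - p(θ')|²`. [folklore] -/
theorem chord_lower (θ θ' : ℝ) :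
    4 * B.umin ^ 2 * Real.sin ((θ - θ') / 2) ^ 2 ≤
      (bandX μ θ - bandX μ θ') ^ 2 + (bandY μ θ - bandY μ θ') ^ 2 := by
  obtain ⟨h1, h2⟩ := B.level hμ
  have hu := B.umin_le μ hμ θ; have hu' := B.umin_le μ hμ θ'
  have hup := B.umin_pos
  have hcos : Real.cos (θ - θ') = 1 - 2 * Real.sin ((θ - θ') / 2) ^ 2 := by
    have := Real.cos_two_mul_eq_one_sub ((θ - θ') / 2)
    rwa [show 2 * ((θ - θ') / 2) = θ - θ' by ring] at this
  have hid : (bandX μ θ - bandX μ θ') ^ 2 + (bandY μ θ - bandY μ θ') ^ 2 =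
      (bandFermiRadius μ θ - bandFermiRadius μ θ') ^ 2 +
        4 * (bandFermiRadius μ θ * bandFermiRadius μ θ') * Real.sin ((θ - θ') / 2) ^ 2 := by
    simp only [bandX, bandY]
    have h3 := Real.cos_sub θ θ'
    have e1 := Real.sin_sq_add_cos_sq θ; have e2 := Real.sin_sq_add_cos_sq θ'
    linear_combination (bandFermiRadius μ θ) ^ 2 * e1 + (bandFermiRadius μ θ') ^ 2 * e2 +
      2 * bandFermiRadius μ θ * bandFermiRadius μ θ' * h3 - 2 * bandFermiRadius μ θ * bandFermiRadius μ θ' * hcos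
  rw [hid]
  have hs2 : 0 ≤ Real.sin ((θ - θ') / 2) ^ 2 := sq_nonneg _
  have hprod : B.umin ^ 2 ≤ bandFermiRadius μ θ * bandFermiRadius μ θ' := by
    rw [sq]; exact mul_le_mul hu hu' hup.le (hup.le.trans hu)
  nlinarith [sq_nonneg (bandFermiRadius μ θ - bandFermiRadius μ θ')]

omit B hμ in
/-- If `|sin y| ≤ ε` and `|y| ≤ π` then `y` is within `(π/2) ε` of `0` or of `±π`. [folklore] -/
theorem near_zero_or_pi_of_abs_sin_le {y ε : ℝ} (hy : |y| ≤ π) (h : |Real.sin y| ≤ ε) :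
    |y| ≤ π / 2 * ε ∨ π - |y| ≤ π / 2 * ε := by
  have hπ := Real.pi_pos
  -- work with `z = |y| ∈ [0, π]`, `|sin z| = |sin y|`
  have hsz : |Real.sin (|y|)| = |Real.sin y| := by
    rcases le_or_gt 0 y with h0 | h0
    · rw [abs_of_nonneg h0]
    · rw [abs_of_neg h0, Real.sin_neg, abs_neg]
  set z := |y| with hz
  have hz0 : 0 ≤ z := abs_nonneg _
  rcases le_or_gt z (π / 2) with hle | hgt
  · left
    have hj := Real.mul_le_sin hz0 hle
    have : Real.sin z ≤ ε := by
      have := le_abs_self (Real.sin z); rw [hsz] at this; linarith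
    have h2 : 2 / π * z ≤ ε := hj.trans this
    rw [div_mul_eq_mul_div, div_le_iff₀ hπ] at h2; linarith
  · right
    have h0' : 0 ≤ π - z := by linarith
    have hle' : π - z ≤ π / 2 := by linarith
    have hj := Real.mul_le_sin h0' hle'
    rw [Real.sin_pi_sub] at hj
    have : Real.sin z ≤ ε := by
      have := le_abs_self (Real.sin z); rw [hsz] at this; linarith
    have h2 : 2 / π * (π - z) ≤ ε := hj.trans this
    rw [div_mul_eq_mul_div, div_le_iff₀ hπ] at h2; linarith

/-- **Few grid points of the curve in a small box**: the grid angles `θ_ω = (ω + ½) w`, `ω < N`,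
`N w = 2π`, whose curve points lie in a box of half-side `r` number at most
`3 (2πε/w + 1)`, `ε = √2 r / u_min`. [folklore] -/
theorem card_grid_in_box_le {N : ℕ} {w r x y : ℝ} (hw : 0 < w) (hN : (N : ℝ) * w = 2 * π) (hr : 0 ≤ r) :
    ((((Finset.range N).filter fun ω : ℕ =>
        |bandX μ (w / 2 + ω * w) - x| ≤ r ∧ |bandY μ (w / 2 + ω * w) - y| ≤ r).card : ℝ)) ≤
      3 * (2 * (π * (Real.sqrt 2 * r / B.umin)) / w + 1) := by
  set S := (Finset.range N).filter fun ω : ℕ =>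
    |bandX μ (w / 2 + ω * w) - x| ≤ r ∧ |bandY μ (w / 2 + ω * w) - y| ≤ r with hS
  set ε := Real.sqrt 2 * r / B.umin with hε
  have hup := B.umin_pos
  have hε0 : 0 ≤ ε := by positivity
  set d₀ := π * ε with hd₀
  have hd0 : 0 ≤ d₀ := by positivity
  rcases S.eq_empty_or_nonempty with hSe | ⟨ω₀, hω₀⟩
  · rw [hSe]; simp; positivity
  · -- every element is close to `ω₀` modulo `N`
    have hmem : ∀ ω ∈ S, |((ω : ℝ) - ω₀) * w| ≤ d₀ ∨ |((ω : ℝ) - ω₀) * w - 2 * π| ≤ d₀ ∨ |((ω : ℝ) - ω₀) * w + 2 * π| ≤ d₀ := by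
      intro ω hω
      rw [hS, Finset.mem_filter, Finset.mem_range] at hω hω₀
      set θ := w / 2 + (ω : ℝ) * w with hθ
      set θ₀ := w / 2 + (ω₀ : ℝ) * w with hθ₀
      have hΔ : θ - θ₀ = ((ω : ℝ) - ω₀) * w := by rw [hθ, hθ₀]; ring
      have hdx : |bandX μ θ - bandX μ θ₀| ≤ 2 * r := by
        calc |bandX μ θ - bandX μ θ₀| = |(bandX μ θ - x) - (bandX μ θ₀ - x)| := by ring_nf
          _ ≤ |bandX μ θ - x| + |bandX μ θ₀ - x| := abs_sub _ _
          _ ≤ 2 * r := by linarith [hω.2.1, hω₀.2.1]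
      have hdy : |bandY μ θ - bandY μ θ₀| ≤ 2 * r := by
        calc |bandY μ θ - bandY μ θ₀| = |(bandY μ θ - y) - (bandY μ θ₀ - y)| := by ring_nf
          _ ≤ |bandY μ θ - y| + |bandY μ θ₀ - y| := abs_sub _ _
          _ ≤ 2 * r := by linarith [hω.2.2, hω₀.2.2]
      have hch := chord_lower B hμ θ θ₀
      have hsq : Real.sin ((θ - θ₀) / 2) ^ 2 ≤ ε ^ 2 := by
        have hx2 : (bandX μ θ - bandX μ θ₀) ^ 2 ≤ (2 * r) ^ 2 := by
          rw [← sq_abs]; exact pow_le_pow_left₀ (abs_nonneg _) hdx 2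
        have hy2 : (bandY μ θ - bandY μ θ₀) ^ 2 ≤ (2 * r) ^ 2 := by
          rw [← sq_abs]; exact pow_le_pow_left₀ (abs_nonneg _) hdy 2
        have : 4 * B.umin ^ 2 * Real.sin ((θ - θ₀) / 2) ^ 2 ≤ 8 * r ^ 2 := by nlinarith
        rw [hε, div_pow, mul_pow, Real.sq_sqrt (by norm_num : (0:ℝ) ≤ 2), le_div_iff₀ (by positivity)]
        nlinarith
      have hsin : |Real.sin ((θ - θ₀) / 2)| ≤ ε := by
        rw [← Real.sqrt_sq hε0, ← Real.sqrt_sq (abs_nonneg (Real.sin ((θ - θ₀) / 2))), sq_abs]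
        exact Real.sqrt_le_sqrt hsq
      -- `|θ - θ₀| < 2π`
      have hωN : (ω : ℝ) < N := by exact_mod_cast hω.1
      have hω₀N : (ω₀ : ℝ) < N := by exact_mod_cast hω₀.1
      have hb1 : (ω : ℝ) * w < 2 * π := by
        calc (ω : ℝ) * w < N * w := mul_lt_mul_of_pos_right hωN hw
          _ = 2 * π := hN
      have hb2 : (ω₀ : ℝ) * w < 2 * π := by
        calc (ω₀ : ℝ) * w < N * w := mul_lt_mul_of_pos_right hω₀N hw
          _ = 2 * π := hN
      have hb3 : 0 ≤ (ω : ℝ) * w := by positivity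
      have hb4 : 0 ≤ (ω₀ : ℝ) * w := by positivity
      have hΔ2 : |θ - θ₀| ≤ 2 * π := by
        rw [hΔ, show ((ω : ℝ) - ω₀) * w = ω * w - ω₀ * w by ring, abs_le]; constructor <;> linarith
      have hlt : |(θ - θ₀) / 2| ≤ π := by
        rw [abs_div, abs_two]; linarith
      have habs : |θ - θ₀| = 2 * |(θ - θ₀) / 2| := by rw [abs_div, abs_two]; ring
      rcases near_zero_or_pi_of_abs_sin_le hlt hsin with hsmall | hlarge
      · left
        rw [← hΔ, habs, hd₀]; linarith
      · right
        rw [← hΔ]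
        have h2 : 2 * π - |θ - θ₀| ≤ d₀ := by rw [habs, hd₀]; linarith
        rcases le_or_gt 0 (θ - θ₀) with hpos | hneg
        · left
          rw [abs_of_nonneg hpos] at h2 hΔ2
          rw [abs_of_nonpos (by linarith : θ - θ₀ - 2 * π ≤ 0)]; linarith
        · right
          rw [abs_of_neg hneg] at h2 hΔ2
          rw [abs_of_nonneg (by linarith : 0 ≤ θ - θ₀ + 2 * π)]; linarith
    -- the three classes
    have hcl : ∀ c : ℝ, (((S.filter fun ω : ℕ => |((ω : ℝ) - ω₀) * w - c| ≤ d₀).card : ℝ)) ≤ 2 * d₀ / w + 1 := by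
      intro c
      refine natCard_le_of_diam (by positivity) fun i hi j hj => ?_
      rw [Finset.mem_filter] at hi hj
      have h1 := hi.2; have h2 := hj.2
      rw [le_div_iff₀ hw]
      have : ((j : ℝ) - i) * w = (((j : ℝ) - ω₀) * w - c) - (((i : ℝ) - ω₀) * w - c) := by ring
      rw [this]
      have := abs_sub_le (((j : ℝ) - ω₀) * w - c) 0 (((i : ℝ) - ω₀) * w - c)
      calc _ ≤ |(((j : ℝ) - ω₀) * w - c) - (((i : ℝ) - ω₀) * w - c)| := le_abs_self _
        _ ≤ |((j : ℝ) - ω₀) * w - c| + |((i : ℝ) - ω₀) * w - c| := abs_sub _ _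
        _ ≤ 2 * d₀ := by linarith
    have hsub : S ⊆ (S.filter fun ω : ℕ => |((ω : ℝ) - ω₀) * w - 0| ≤ d₀) ∪
        ((S.filter fun ω : ℕ => |((ω : ℝ) - ω₀) * w - 2 * π| ≤ d₀) ∪
          (S.filter fun ω : ℕ => |((ω : ℝ) - ω₀) * w - (-(2 * π))| ≤ d₀)) := by
      intro ω hω
      rcases hmem ω hω with h | h | h
      · exact Finset.mem_union_left _ (Finset.mem_filter.2 ⟨hω, by simpa using h⟩)
      · exact Finset.mem_union_right _ (Finset.mem_union_left _ (Finset.mem_filter.2 ⟨hω, h⟩))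
      · exact Finset.mem_union_right _ (Finset.mem_union_right _ (Finset.mem_filter.2 ⟨hω, by rwa [sub_neg_eq_add]⟩))
    calc (S.card : ℝ) ≤ (((S.filter fun ω : ℕ => |((ω : ℝ) - ω₀) * w - 0| ≤ d₀) ∪
        ((S.filter fun ω : ℕ => |((ω : ℝ) - ω₀) * w - 2 * π| ≤ d₀) ∪
          (S.filter fun ω : ℕ => |((ω : ℝ) - ω₀) * w - (-(2 * π))| ≤ d₀))).card : ℝ) := by
          exact_mod_cast Finset.card_le_card hsub
      _ ≤ ((S.filter fun ω : ℕ => |((ω : ℝ) - ω₀) * w - 0| ≤ d₀).card : ℝ) +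
          (((S.filter fun ω : ℕ => |((ω : ℝ) - ω₀) * w - 2 * π| ≤ d₀).card : ℝ) +
            ((S.filter fun ω : ℕ => |((ω : ℝ) - ω₀) * w - (-(2 * π))| ≤ d₀).card : ℝ)) := by
          have h1 := Finset.card_union_le (S.filter fun ω : ℕ => |((ω : ℝ) - ω₀) * w - 0| ≤ d₀)
            ((S.filter fun ω : ℕ => |((ω : ℝ) - ω₀) * w - 2 * π| ≤ d₀) ∪
              (S.filter fun ω : ℕ => |((ω : ℝ) - ω₀) * w - (-(2 * π))| ≤ d₀))
          have h2 := Finset.card_union_le (S.filter fun ω : ℕ => |((ω : ℝ) - ω₀) * w - 2 * π| ≤ d₀)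
            (S.filter fun ω : ℕ => |((ω : ℝ) - ω₀) * w - (-(2 * π))| ≤ d₀)
          have h1' : (((S.filter fun ω : ℕ => |((ω : ℝ) - ω₀) * w - 0| ≤ d₀) ∪
            ((S.filter fun ω : ℕ => |((ω : ℝ) - ω₀) * w - 2 * π| ≤ d₀) ∪
              (S.filter fun ω : ℕ => |((ω : ℝ) - ω₀) * w - (-(2 * π))| ≤ d₀))).card : ℝ) ≤
            ((S.filter fun ω : ℕ => |((ω : ℝ) - ω₀) * w - 0| ≤ d₀).card : ℝ) +
            (((S.filter fun ω : ℕ => |((ω : ℝ) - ω₀) * w - 2 * π| ≤ d₀) ∪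
              (S.filter fun ω : ℕ => |((ω : ℝ) - ω₀) * w - (-(2 * π))| ≤ d₀)).card : ℝ) := by
            exact_mod_cast h1
          have h2' : (((S.filter fun ω : ℕ => |((ω : ℝ) - ω₀) * w - 2 * π| ≤ d₀) ∪
              (S.filter fun ω : ℕ => |((ω : ℝ) - ω₀) * w - (-(2 * π))| ≤ d₀)).card : ℝ) ≤
            ((S.filter fun ω : ℕ => |((ω : ℝ) - ω₀) * w - 2 * π| ≤ d₀).card : ℝ) +
              ((S.filter fun ω : ℕ => |((ω : ℝ) - ω₀) * w - (-(2 * π))| ≤ d₀).card : ℝ) := by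
            exact_mod_cast h2
          linarith
      _ ≤ (2 * d₀ / w + 1) + ((2 * d₀ / w + 1) + (2 * d₀ / w + 1)) := add_le_add (hcl 0) (add_le_add (hcl _) (hcl _))
      _ = 3 * (2 * (π * ε) / w + 1) := by rw [hd₀]; ring

/-- **From the sum condition to the level function**: if `p(θ₄)` completes the sum of three curve
points to `2πG` within `r` (coordinatewise) then `|h(θ₂, θ₃)| ≤ 4r`. [folklore] -/
theorem abs_hfun_le_of_sum {θ₁ θ₂ θ₃ θ₄ r : ℝ} {G₀ G₁ : ℤ}
    (hx : |bandX μ θ₁ + bandX μ θ₂ + bandX μ θ₃ + bandX μ θ₄ - 2 * π * G₀| ≤ r)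
    (hy : |bandY μ θ₁ + bandY μ θ₂ + bandY μ θ₃ + bandY μ θ₄ - 2 * π * G₁| ≤ r) :
    |hfun μ θ₁ θ₂ θ₃| ≤ 4 * r := by
  obtain ⟨h1, h2⟩ := B.level hμ
  set e₀ := bandX μ θ₁ + bandX μ θ₂ + bandX μ θ₃ + bandX μ θ₄ - 2 * π * G₀ with he₀
  set e₁ := bandY μ θ₁ + bandY μ θ₂ + bandY μ θ₃ + bandY μ θ₄ - 2 * π * G₁ with he₁
  have hSX : SX μ θ₁ θ₂ θ₃ = (-bandX μ θ₄ + e₀) - (-G₀ : ℤ) * (2 * π) := by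
    unfold SX; rw [he₀]; push_cast; ring
  have hSY : SY μ θ₁ θ₂ θ₃ = (-bandY μ θ₄ + e₁) - (-G₁ : ℤ) * (2 * π) := by
    unfold SY; rw [he₁]; push_cast; ring
  have hμ4 : eps2 (-bandX μ θ₄) (-bandY μ θ₄) = μ := by rw [eps2_neg]; exact eps2_bandXY h1 h2 θ₄
  unfold hfun
  rw [hSX, hSY, eps2_sub_int_mul]
  have hrw : eps2 (-bandX μ θ₄ + e₀) (-bandY μ θ₄ + e₁) - μ =
      eps2 (-bandX μ θ₄ + e₀) (-bandY μ θ₄ + e₁) - eps2 (-bandX μ θ₄) (-bandY μ θ₄) := by rw [hμ4]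
  rw [hrw]
  calc |eps2 (-bandX μ θ₄ + e₀) (-bandY μ θ₄ + e₁) - eps2 (-bandX μ θ₄) (-bandY μ θ₄)|
      ≤ 2 * (|(-bandX μ θ₄ + e₀) - (-bandX μ θ₄)| + |(-bandY μ θ₄ + e₁) - (-bandY μ θ₄)|) := abs_eps2_sub_eps2_le _ _ _ _
    _ = 2 * (|e₀| + |e₁|) := by ring_nf
    _ ≤ 4 * r := by linarith

end Cell

/-! ## Two summation lemmas: the harmonic bound and the dyadic bound -/

/-- **Harmonic bound**: `Σ_{k < N, k ≠ c} 1/|k - c| ≤ 2 (1 + log N)`. [folklore] -/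
theorem sum_inv_abs_sub_le {N c : ℕ} (hc : c < N) :
    ∑ k ∈ (Finset.range N).filter (fun k => k ≠ c), 1 / |(k : ℝ) - c| ≤ 2 * (1 + Real.log N) := by
  have hharm : ∑ m ∈ Finset.range N, 1 / ((m : ℝ) + 1) ≤ 1 + Real.log N := by
    -- `harmonic_le_one_add_log`, cast to `ℝ` (cf. `sum_range_one_div_succ_le_log` elsewhere in the tree)
    have h := harmonic_le_one_add_log N
    simp only [harmonic, Rat.cast_sum, Rat.cast_inv, Nat.cast_add, Nat.cast_one] at h
    simpa [one_div] using h
  have hlog : 0 ≤ 1 + Real.log N := by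
    have : (1 : ℝ) ≤ N := by exact_mod_cast Nat.succ_le_of_lt (Nat.lt_of_le_of_lt (Nat.zero_le c) hc)
    have := Real.log_nonneg this; linarith
  set S₁ := (Finset.range N).filter (fun k => k < c) with hS₁
  set S₂ := (Finset.range N).filter (fun k => c < k) with hS₂
  have hsplit : (Finset.range N).filter (fun k => k ≠ c) = S₁ ∪ S₂ := by
    ext k; simp only [Finset.mem_filter, Finset.mem_range, Finset.mem_union, hS₁, hS₂]; omega
  have hdisj : Disjoint S₁ S₂ := by
    rw [Finset.disjoint_left]; intro k hk1 hk2
    rw [hS₁, Finset.mem_filter] at hk1; rw [hS₂, Finset.mem_filter] at hk2; omega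
  rw [hsplit, Finset.sum_union hdisj]
  -- upper part
  have h2 : ∑ k ∈ S₂, 1 / |(k : ℝ) - c| ≤ 1 + Real.log N := by
    have heq : ∀ k ∈ S₂, 1 / |(k : ℝ) - c| = 1 / ((((k - c - 1 : ℕ)) : ℝ) + 1) := by
      intro k hk
      rw [hS₂, Finset.mem_filter] at hk
      have hle : c + 1 ≤ k := hk.2
      rw [Nat.cast_sub (by omega : 1 ≤ k - c), Nat.cast_sub (by omega : c ≤ k)]
      rw [abs_of_pos (sub_pos.2 (by exact_mod_cast hk.2))]
      push_cast; ring
    rw [Finset.sum_congr rfl heq]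
    have hinj : Set.InjOn (fun k => k - c - 1) (S₂ : Set ℕ) := by
      intro x hx y hy hxy
      rw [Finset.mem_coe, hS₂, Finset.mem_filter] at hx hy
      simp only at hxy; omega
    rw [← Finset.sum_image (f := fun m : ℕ => 1 / ((m : ℝ) + 1)) hinj]
    refine le_trans (Finset.sum_le_sum_of_subset_of_nonneg ?_ fun i _ _ => by positivity) hharm
    intro m hm
    rw [Finset.mem_image] at hm
    obtain ⟨k, hk, rfl⟩ := hm
    rw [hS₂, Finset.mem_filter, Finset.mem_range] at hk
    rw [Finset.mem_range]; omega
  -- lower part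
  have h1 : ∑ k ∈ S₁, 1 / |(k : ℝ) - c| ≤ 1 + Real.log N := by
    have heq : ∀ k ∈ S₁, 1 / |(k : ℝ) - c| = 1 / ((((c - k - 1 : ℕ)) : ℝ) + 1) := by
      intro k hk
      rw [hS₁, Finset.mem_filter] at hk
      rw [Nat.cast_sub (by omega : 1 ≤ c - k), Nat.cast_sub (by omega : k ≤ c)]
      rw [abs_of_neg (sub_neg.2 (by exact_mod_cast hk.2))]
      push_cast; ring
    rw [Finset.sum_congr rfl heq]
    have hinj : Set.InjOn (fun k => c - k - 1) (S₁ : Set ℕ) := by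
      intro x hx y hy hxy
      rw [Finset.mem_coe, hS₁, Finset.mem_filter] at hx hy
      simp only at hxy; omega
    rw [← Finset.sum_image (f := fun m : ℕ => 1 / ((m : ℝ) + 1)) hinj]
    refine le_trans (Finset.sum_le_sum_of_subset_of_nonneg ?_ fun i _ _ => by positivity) hharm
    intro m hm
    rw [Finset.mem_image] at hm
    obtain ⟨k, hk, rfl⟩ := hm
    rw [hS₁, Finset.mem_filter, Finset.mem_range] at hk
    rw [Finset.mem_range]; omega
  linarith

/-- **Dyadic bound**: for non-negative values `v_s`, the sum of
`b_s = A₀` (`v_s ≤ 2δ`) / `κ/√v_s` (`v_s > 2δ`) is controlled by the level counts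
`#{v ≤ 2^{j+1} δ}`, `j = 0, …, J`, plus a tail. [folklore] -/
theorem dyadic_sum_le {ι : Type*} (T : Finset ι) (v : ι → ℝ) {δ κ A₀ : ℝ} (hδ : 0 < δ) (hκ : 0 ≤ κ) (J : ℕ) :
    ∑ s ∈ T, (if v s ≤ 2 * δ then A₀ else κ / Real.sqrt (v s)) ≤
      A₀ * ((T.filter fun s => v s ≤ 2 * δ).card : ℝ) +
      ∑ j ∈ Finset.Icc 1 J, κ / Real.sqrt (2 ^ j * δ) * ((T.filter fun s => v s ≤ 2 ^ (j + 1) * δ).card : ℝ) +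
      (T.card : ℝ) * (κ / Real.sqrt (2 ^ (J + 1) * δ)) := by
  -- pointwise bound
  have hpt : ∀ s ∈ T, (if v s ≤ 2 * δ then A₀ else κ / Real.sqrt (v s)) ≤
      A₀ * (if v s ≤ 2 * δ then 1 else 0) +
      ∑ j ∈ Finset.Icc 1 J, κ / Real.sqrt (2 ^ j * δ) * (if v s ≤ 2 ^ (j + 1) * δ then 1 else 0) +
      κ / Real.sqrt (2 ^ (J + 1) * δ) := by
    intro s hs
    have hterms : ∀ j ∈ Finset.Icc 1 J, 0 ≤ κ / Real.sqrt (2 ^ j * δ) * (if v s ≤ 2 ^ (j + 1) * δ then (1:ℝ) else 0) := by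
      intro j _; split_ifs <;> positivity
    have hsum0 : 0 ≤ ∑ j ∈ Finset.Icc 1 J, κ / Real.sqrt (2 ^ j * δ) * (if v s ≤ 2 ^ (j + 1) * δ then (1:ℝ) else 0) :=
      Finset.sum_nonneg hterms
    have htail0 : 0 ≤ κ / Real.sqrt (2 ^ (J + 1) * δ) := by positivity
    split_ifs with h0
    · linarith [mul_one A₀]
    · push Not at h0
      have hv0 : 0 < v s := by linarith
      simp only [mul_zero, zero_add]
      by_cases htail : 2 ^ (J + 1) * δ < v s
      · -- tail
        have : κ / Real.sqrt (v s) ≤ κ / Real.sqrt (2 ^ (J + 1) * δ) :=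
          div_le_div_of_nonneg_left hκ (Real.sqrt_pos.2 (by positivity)) (Real.sqrt_le_sqrt htail.le)
        linarith
      · push Not at htail
        -- the least `j ≥ 1` with `v ≤ 2^{j+1} δ`
        have hJ : 1 ≤ J := by
          rcases Nat.eq_zero_or_pos J with hJ0 | hJ0
          · exfalso; rw [hJ0] at htail; norm_num at htail; linarith
          · exact hJ0
        have hex : ∃ j, 1 ≤ j ∧ v s ≤ 2 ^ (j + 1) * δ := ⟨J, hJ, htail⟩
        classical
        obtain ⟨j₀, hj₀def⟩ : ∃ j₀, j₀ = Nat.find hex := ⟨_, rfl⟩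
        have hj₀ : 1 ≤ j₀ ∧ v s ≤ 2 ^ (j₀ + 1) * δ := by rw [hj₀def]; exact Nat.find_spec hex
        have hj₀J : j₀ ≤ J := by rw [hj₀def]; exact Nat.find_min' hex ⟨hJ, htail⟩
        have hlow : 2 ^ j₀ * δ < v s := by
          by_contra hcon
          push Not at hcon
          rcases hj₀.1.eq_or_lt with h1 | h1
          · rw [← h1, pow_one] at hcon; linarith
          · have hmin := Nat.find_min hex (m := j₀ - 1) (by rw [← hj₀def]; omega)
            apply hmin
            refine ⟨by omega, ?_⟩
            rwa [Nat.sub_add_cancel (by omega)]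
        have hmem : j₀ ∈ Finset.Icc 1 J := Finset.mem_Icc.2 ⟨hj₀.1, hj₀J⟩
        have hle : κ / Real.sqrt (v s) ≤ κ / Real.sqrt (2 ^ j₀ * δ) :=
          div_le_div_of_nonneg_left hκ (Real.sqrt_pos.2 (by positivity)) (Real.sqrt_le_sqrt hlow.le)
        have hsingle : κ / Real.sqrt (2 ^ j₀ * δ) * (if v s ≤ 2 ^ (j₀ + 1) * δ then (1:ℝ) else 0) ≤
            ∑ j ∈ Finset.Icc 1 J, κ / Real.sqrt (2 ^ j * δ) * (if v s ≤ 2 ^ (j + 1) * δ then (1:ℝ) else 0) :=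
          Finset.single_le_sum hterms hmem
        rw [if_pos hj₀.2, mul_one] at hsingle
        linarith
  refine (Finset.sum_le_sum hpt).trans (le_of_eq ?_)
  rw [Finset.sum_add_distrib, Finset.sum_add_distrib, Finset.sum_comm, ← Finset.mul_sum, Finset.sum_boole,
    Finset.sum_const, nsmul_eq_mul]
  congr 1; congr 1
  refine Finset.sum_congr rfl fun j _ => ?_
  rw [← Finset.mul_sum, Finset.sum_boole]

end Literature.MathematicalPhysics.QuantumLattice.BandSectorCounting

end
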